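import Mathlib
import HarnessLib
import HarnessLib.Audit
import Summits.BirchSwinnertonDyer.Statement
import Summits.BirchSwinnertonDyer.Rank1Residual.WAll.Target
import Summits.BirchSwinnertonDyer.Rank1Residual.WAll.TargetPrimeSlices
import Summits.BirchSwinnertonDyer.BirchSwinnertonDyer.Theorems.SignedSupersingularInputs
import Literature.NumberTheory.EllipticCurves.BurungaleSkinnerTianWan2024.GreenbergMainStatementOPEN
import Literature.NumberTheory.EllipticCurves.BurungaleSkinnerTianWan2024.GreenbergLFunctionSupersingularExistsPRE
import Literature.NumberTheory.EllipticCurves.BurungaleCastellaSkinner2025.GreenbergMuInvariantGoodReduction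
import Literature.NumberTheory.EllipticCurves.BurungaleSkinnerTianWan2024.SignedTwoVariableDescentPackagePRE
import Summits.BirchSwinnertonDyer.BirchSwinnertonDyer.Theorems.SignedBaseChangeDefiniteAnchorDefs
import Summits.BirchSwinnertonDyer.BirchSwinnertonDyer.Theorems.SignedLowerHalvesRealPeriodUnitPlusPeriod
import HarnessLib.Audit.Status.Attr

/-!
Route: SignedBaseChange

# Route SignedBaseChange — real-quadratic base change (n⁻ = 1) makes the signed Eisenstein lower
bound reach additive X7 pairs with no Steinberg prime

It suffices to show X = K1″ ∧ K2 ∧ K3 for the slice leaf `WAllCornerX7FiveLe` (W-ALL/7.p≥5: BSD_p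
for non-CM E/ℚ, p ≥ 5 of good SUPERSINGULAR reduction, E NOT semistable, analytic rank ≤ 1; `closes`
re-targeted at rev 5 from the row leaf `WAllCornerX7` = `WAllCornerX7AtThree ∧ WAllCornerX7FiveLe`
(`wAllCornerX7_iff_three_fiveLe`) to the p ≥ 5 slice, residual-free). K1″
(TwistPairGreenbergProductDivisibilityCanonical, gen 6 = rev 14′; K1′ = …Split (gen 4–5) and K1
(gens 0–3) are ASIDES, K1″ ⇒ K1′ ⇒ K1 by dropping conjuncts): for p ≥ 5, an X7 pair with surjective
ρ̄ admits an imaginary quadratic K (p split and every ℓ ∣ N·N′ split, so each factor is indefinite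
over K and the pair is the definite n⁻ = 1 datum over F), a quadratic twist E^(d) ramified away from
pN·D_K, the (cyclotomic, anticyclotomic) tower with an adapted generator pair whose cyclotomic
generator γ₁ is CANONICAL up to torsion (χ_cyc,K(γ₁)·ζ = 1 + p — the one conjunct added at rev 14′,
so that the signed cyclotomic-line package below is instantiable), and the BSTW two-variable
GREENBERG divisibility for the PRODUCT ch(X_Gr(E/K_∞))·ch(X_Gr(E^(d)/K_∞)) ⊆
(L_p^Gr(E/K)·L_p^Gr(E^(d)/K)) up to a nonzero factor constant in the anticyclotomic variable,
uniformly over the Katz/Greenberg frames — the ℚ-shadow of a U(3,1) Eisenstein congruence over the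
real quadratic F = ℚ(√d), where [F:ℚ] even lets the definite datum have n⁻ = 1 (no Steinberg prime
needed). K2, realised since gen 3 as frame binder + descent and since rev 14′ as GSF +
SignedTwoVariableInputs + K2R⁗: GSF (GreenbergSupersingularFrameInput) = the cite-only PREPRINT
binder
`BurungaleSkinnerTianWan2024.thm617_exists_commonKatzFrame_isGreenbergLFunctionAnyRoot₂_supersingular_PRE`
(BSTW §6.4/Thm 6.17: one Katz frame per K-data carrying an integral Greenberg 𝓛_p^Gr(f/K) for every
admissible supersingular newform) supplies the frames K1″ quantifies over; SignedTwoVariableInputs =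
the cite-only conjunction of the GUARDED BCS25 Prop 4.2.2 μ-input
`BurungaleCastellaSkinner2025.prop422_greenbergAnyRoot_hasUnitContent_minus` (μ(L_p^Gr(g/K)) = 0 on
the minus line at good p under Heegner; the unguarded typing v1 is kernel-refuted and never cited)
and bsd-wall-ty-1's BSTW signed two-variable package PRE
`BurungaleSkinnerTianWan2024.props118_27_519_exists_signedTwoVariablePackage_supersingular_PRE`
((P1) ξ·𝓛^Gr = Char(X_Gr)^ur·𝓛^∘ over any frame; (P2) anticyclotomic control and (P3) cyclotomic
factorisation on the canonical cyclotomic line); and K2R⁗ (SignedLowerDescentFromTwoVariablePackage,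
BY-NAME form): Kobayashi's Kato-side divisibility and control (thm41, thm12), modularity and the
period unit (PUB aliases), GSF, the two signed inputs and K1″ BY NAME turn the product package into
the EISENSTEIN HALF `KobayashiLowerDivisibility W p ε` for both signs (cancel the slack by μ = 0,
transfer by (P1), descend by (P2)/(P3), squeeze the four ℚ-curves E, E^(D_K), E^(d), E^(dD_K)
against Kobayashi Thm 4.1), and the glue item KobayashiSqueeze (proved, p516518) with PUB's
period-unit conjunct squeezes it to Kobayashi's ± main conjecture; K2R‴
(SignedLowerDescentFromCommonFrame, rev 12), K2R′, K2, F, K2R stay in the file as ASIDES. K3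
(KobayashiMainConjectureSmallImage, shared with route SignedLowerHalves): the 84 non-surjective X7
pairs. R (CornerX7AtThree) = the p = 3 slice `WAllCornerX7AtThree` verbatim is NOT attacked and,
since rev 5, not a binder of `closes` (ASIDE; the p = 3 slice is its own registered leaf, owner rung
K3 `SignedSupersingular`). The tree's consumers (rank 0: BDKim2013 Cor 3.15; rank 1:
BurungaleKobayashiOta2023 Cor A.5 + GZK) then give BSD_p.
Lean: `TwistPairGreenbergProductDivisibilityCanonical ∧ GreenbergSupersingularFrameInput ∧
SignedTwoVariableInputs ∧ SignedLowerDescentFromTwoVariablePackage ∧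
KobayashiMainConjectureSmallImage`

## Assembly
Pure logic plus the tree's landed consumers: `closes : K1″ → GSF → SignedTwoVariableInputs → K2R⁗ →
K3 → PublishedSignedInputs → KobayashiSqueeze → WAllCornerX7FiveLe` (rev 14′; rev 8–13: K1/K1′ → GSF
→ K2R′/K2R″/K2R‴ → K3 → PUB (→ Sq); rev 5–7: K1 → K2 → K3 → PUB) is proved INLINE (the 5 ≤ p branch
of the landed `Theorems/SignedBaseChangeAssembly.assembly_holds`, p503192; the old Assembly item
stays CLOSED as an aside): fix W, 5 ≤ p with ¬CM, ClassX7, analytic rank ≤ 1 (p ≠ 2 by omega). Then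
a_p = 0 (`Rank1Residual.Supersingular.ClassX7.frobeniusTrace_eq_zero_of_five_le`); Surj ⇒ K2R⁗
(thm41, thm12, modularity, period unit from the support; GSF; the signed inputs; K1″) gives the
Eisenstein half for ε = 1 and KobayashiSqueeze (period unit: PUB conjunct 6 via
`padicValRat_periodRatio_eq_zero_of_five_le`, `ClassX7.irr`) gives KMC; ¬Surj ⇒ K3 gives KMC for
some ε; then rank 0: `Supersingular.bsdp_of_kobayashiMainConjecture_of_analyticRank_eq_zero` (with
`pollack_exists_plusMinusPAdicLFunction_holds`, BDKim2013 Cor 3.15, `ClassX7.irr`), rank 1: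
`Supersingular.X7.bsdp_of_kobayashiMainConjecture_of_corA5_of_analyticRank_eq_one`. Certified:
Sketch14.lean (rc 0 · 0 sorry) and `route check --native` at apply time.

CLOSES_TARGET: closes rung W-ALL/7.p>=5 of BirchSwinnertonDyer: Summit.BirchSwinnertonDyer.WAllCornerX7FiveLe (D-0061; not the summit Statement) — the deciding theorem of this route concludes that registered leaf instead of the Statement decl `BirchSwinnertonDyer` (class rung: servable and labelled, never counted as concluding the summit Statement).

Rationale: WHY THIS LINE. Every printed Eisenstein-side (lower-bound) divisibility at a supersingular p over ℚ
— Wan2020/arXiv:1411.6352, CastellaLiuWan2022, BurungaleSkinnerTianWan2024 Thm 1.24/9.24 — needs a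
prime q ∥ N non-split in K ((spl): the definite unitary/quaternionic datum over ℚ must ramify at a
finite prime), so the 28 + 1 098 X7 pairs whose bad primes are all additive are out of reach of the
cell's existing lines (FW-locus, twist transport, CONG-λ all import a multiplicative prime). The
lever is Wan2015HilbertIMC Remark 5 / p. 92 and BurungaleCastellaSkinner2025 §5 (ordinary):
base-change g to a real quadratic F; [F:ℚ] = 2 is even, so the definite datum ramifies at ∞₁∞₂ only
and n⁻ = 1 is allowed (BCS25 Prop 5.2.1: «n⁻ = O_F, hypotheses (iii),(iv) vacuous»), and over K the
three-variable Selmer object splits into FOUR pieces over ℚ (E, E^(d), and their K-twists), where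
Kato–Kobayashi apply. Imported: automorphic base change GL₂/ℚ → GL₂/F and Eisenstein congruences on
U(3,1)/F (automorphic forms), two-variable ± Coleman maps (BDKim2013, Büyükboduk–Lei–Loeffler–Venkat
2019) for the descent. What it does that SignedLowerHalves (items 19001/19002: BSTW (spl) + level
raising), InertBadSignedBranches and QuadraticBranchSignedControl do not: it removes the
Steinberg-prime hypothesis at the SOURCE (parity of [F:ℚ]) instead of importing one by level raising
or twisting; the negatives index (1 entry, ordinary-prime existence) is untouched.

RANKED CRUXES. (rev 14′ = gen 6, 2026-08-28 freeze-end package of planner bsd-wall-ss g4; LIVE items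
first, banked asides after.)
#2″ TwistPairGreenbergProductDivisibilityCanonical (crux, rank 2 = the DECIDING crux; K1″; rev 14″:
stated MODULO the published inputs `SignedTwoVariableInputs →` (#3g) so that proofs consuming the
named μ-fact close it outright — live line `acanchor`: K1″ ⇐ TwoVariableEulerSystemDivisibility ∧
AnticyclotomicEisensteinDivisibility, glue LANDED p534867/p536497 + certified Sketch18, split staged
HOME/bsd-wall-ss/rev15-AC) — Modularity (BCDT, named fact) ⇒ for every globally minimal elliptic
W/ℚ, p ≥ 5, ClassX7 W p, ρ̄ surjective: there exist an imaginary quadratic K with p = v·v̄ split and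
every prime ℓ ∣ N·N′ split ((Heeg) for N as `∀ ℓ ∣ N, #primesOver = 2`, plus «ℓ ∣ d» and «2»), (N,
D_K) = 1, E[p]|G_K absolutely irreducible, the cyclotomic/anticyclotomic ℤ_p-extensions κ₁, κ₂ with
an adapted generator pair (γ₁, γ₂) whose γ₁ is CANONICAL UP TO TORSION (χ_cyc,K(γ₁)·ζ = 1 + p — the
one conjunct added at rev 14′, byte-identical to bsd-wall-ty-1's COORDINATE-CLAUSE-gamma1-v1), the
newform f of W, a square-free d > 1 ramified only at primes q ∤ pN·D_K, the minimal model W′ of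
W^(d) with newform f′, such that for every Katz frame with Ω ≠ 0 and every pair of Greenberg p-adic
L-functions G, G′ of f, f′ over it (BSTW `IsGreenbergLFunctionAnyRoot₂`) and every structure map J
there is s ≠ 0 in 𝒪_ℂp⟦T₁⟧ with C(s)·ch(X_Gr₂(W/K))^ur·ch(X_Gr₂(W′/K))^ur ⊆ (G·G′) — the BSTW Thm
9.24 conclusion for the PRODUCT with NO square-free and NO (spl) hypothesis. K1″ ⇒ K1′ ⇒ K1 by
dropping conjuncts (Sketch14 `k1split_of_k1canonical`, Sketch5 `k1_of_k1split`). WHY THE NEW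
CONJUNCT: the signed package (P2)/(P3) of #3g lives on the canonical cyclotomic line over ℚ; K1′'s
`κ₁.IsCyclotomic` pins ker κ₁ only, so the normalisation is stated where γ₁ is born (cost nil for
the constructor: Sketch14 `canonical_of_isTopGenerator` + tree
`MuZeroCMKatzFrame.exists_isCyclotomic_isTopGenerator_normalised`). [difficulty: XL;
conjecture-grade, director W-9: prover line dead at birth, strategist seat cstrat + the typed split
R3 «K1″ ⇐ GreenbergLowerHalfConj912 (rev15-R3/A.sig, ONE text per W-11 (e)) ∧ frame data FD″»] (why
it might fail: K1″ is the K-currency shadow of ONE unprinted theorem — a P-ordinary GU(3,1)_{M/F}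
Eisenstein divisibility for the base change g_F, F = ℚ(√d), with the totally definite B/F (CLW22 Thm
8.2.1(1) transplanted; gaps G1 P-ordinary control + Klingen family over F ≠ ℚ, G2 wild additive
local triple products); BSTW 9.24 / Wan are printed for square-free N with (spl).)
[BurungaleSkinnerTianWan2024, Wan2015HilbertIMC, BurungaleCastellaSkinner2025, CastellaLiuWan2022,
arXiv:2409.03783, MazurTateTeitelbaum1986, Hsieh2014]
#3f SignedLowerDescentFromTwoVariablePackage (crux, rank 3; K2R⁗, BY-NAME form, 675 chars) —
Kobayashi2003 Thm 4.1 → Thm 1.2 → ModularParametrizationSupply → RealPeriodUnitPlusPeriod → GSF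
(#3c) → SignedTwoVariableInputs (#3g) → K1″ (#2″, by name) → for p ≥ 5, ClassX7, Surj and every sign
ε: `KobayashiLowerDivisibility W p ε` (the EISENSTEIN HALF: char X^ε = (g), ι g = ϖ·ι(L^ε·h)); the
squeeze to Kobayashi's main conjecture is the PROVED glue #9b. Conclusion identical to K2R‴ (rev
12); the antecedents now name every published/preprint input the descent consumes, so a proof is
commutative algebra + dictionary (BSTW §2.3 p. 76): common frame (GSF) at K1″'s data; K1″'s product
divisibility with slack s; μ((G·G′)⁻) = 0 from #3g conjunct 1 twice (sbc-p2
`stub_muZero_of_prop422GreenbergAnyRoot`, p528542) ⇒ cancel s (`stub_delocalise`, p525141); (P1) for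
f, f′ + `map_mul_dvd_map_mul_of_package` (ty-1) ⇒ ξ·ξ′-divisibility; canonical line γ := γ₁|_ℚ̄
(K1″'s conjunct via `isCyclotomicVariable_absGaloisRestrict_iff`); (P2)+(P3) ⇒ L^ε-products ∣
unit·ξ(X^ε)-products, coefficient descent 𝒪_ℂp⟦T⟧ → ℤ_p⟦T⟧; Kobayashi Thm 4.1 for E, E^(D_K), E^(d),
E^(dD_K) ⇒ product squeeze ⇒ factor-wise equality up to units (p518504, p520425). WHY BY NAME: the
pointwise text is 4 185 chars > the 4 000-char cap, and by-name retires the «package texts must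
match verbatim» seam behind the binder omissions F3 (rev 12) and F4′. [deps:
TwistPairGreenbergProductDivisibilityCanonical, SignedTwoVariableInputs,
GreenbergSupersingularFrameInput] [difficulty: M–L] (why it might fail: dictionary seams only —
Kobayashi's ε vs BSTW's ±/∘ (`UnrSeries₂.plus`), `IsSignedPAdicLFunction` ↔ Summit-side
`kobayashiL`/Pollack pairs (unit, p-adic period), minimal models/newforms and the Thm 4.1 hypotheses
for the three auxiliary twists; each such seam already cost one restate.) [Kobayashi2003,
BurungaleSkinnerTianWan2024, BurungaleCastellaSkinner2025, BDKim2013, Pollack2003]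
#3c GreenbergSupersingularFrameInput (support, cite-only PREPRINT binder, gen 3; item
stmt-BirchSwinnertonDyer-20330, UNCHANGED) — verbatim
`BurungaleSkinnerTianWan2024.thm617_exists_commonKatzFrame_isGreenbergLFunctionAnyRoot₂_supersingular_PRE`
(arXiv:2409.01350v2 §6.4 + Thm 6.17 ERL II′ + §6.6.1, [claim: under-review]): for p ≥ 5 and
imaginary quadratic K with p split, the tower and any adapted generator pair, ONE Katz frame (Ω ≠ 0,
δ² = ±D_K, Ω_p a unit, `IsKatzMeasure₂`) over which EVERY newform f_E supersingular at p (p ∤ N_E,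
a_p = 0, (N_E, D_K) = 1) has an integral Greenberg function G (`IsGreenbergLFunctionAnyRoot₂`). The
gen-5 plan to conjoin the μ-input HERE (option G, rev14G.sh) is RETIRED: its text cited the
unguarded v1 μ-fact, kernel-refuted since (`prop422_grHalf_hasUnitContent_minus.false_of_instance`);
the μ-input now lives in #3g, guarded. [difficulty: cite-only] [BurungaleSkinnerTianWan2024,
YanZhu2024MainConjNonCM, CastellaGrossiSkinner2025, deShalit1987]
#3g SignedTwoVariableInputs (support, cite-only, gen 6) — the BY-NAME conjunction
`BurungaleCastellaSkinner2025.prop422_greenbergAnyRoot_hasUnitContent_minus ∧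
BurungaleSkinnerTianWan2024.props118_27_519_exists_signedTwoVariablePackage_supersingular_PRE`: (1)
BCS25 = arXiv:2405.00270v2 Prop 4.2.2 (p. 9), μ(L_p^Gr(g/K)) = 0 on the minus line at GOOD reduction
p > 2 under (Heeg)+(spl)+(disc)+(irr_K), GUARDED v2 (genuine period data Ω ≠ 0; typed p524597;
Hsieh2014 Thm B + Gr/BDP comparison); (2) the BSTW signed two-variable package PRE (Props 1.18, 2.7,
5.19 + §6.4 (sspLcy) + Kobayashi dictionary; typed p528812 by bsd-wall-ty-1, director W-10 «ONE
conjoined-∃ PRE package»): (P1) (ξ·G) = Char(X_Gr)^ur·(𝓛^∘) over any frame, (P2) ξ⁺ ∣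
ξ(X^ε(E))·ξ(X^ε(E^(D_K))) and (P3) 𝓛^{∘,+} = u·L^ε(f)·L^ε(f₂) on the canonical cyclotomic line.
[difficulty: cite-only] [BurungaleCastellaSkinner2025, Hsieh2014, BurungaleSkinnerTianWan2024,
Kobayashi2003, BDKim2013]
#9b KobayashiSqueeze (support · glue, gen 4; item stmt-BirchSwinnertonDyer-20504, CLOSED·proved
p516518 =
`Theorems.SignedBaseChangeK2RSqueeze.kobayashiMainConjecture_of_lowerDivisibility_of_periodUnit`) —
under Surj: thm12 + thm41 + ord_p ϖ = 0 + KobayashiLowerDivisibility ⇒ KobayashiMainConjecture;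
`closes` feeds it PUB's period-unit conjunct through `padicValRat_periodRatio_eq_zero_of_five_le`
and `ClassX7.irr`. [Kobayashi2003, GreenbergVatsal2000]
#4 KobayashiMainConjectureSmallImage (crux, rank 4; verbatim the shared item
stmt-BirchSwinnertonDyer-19002 of route SignedLowerHalves) — for odd p, ClassX7, non-CM, a_p = 0 and
ρ̄_{E,p} NOT surjective, Kobayashi's main conjecture holds for some sign ε. [difficulty: L] (why it
might fail: Kobayashi2003 Thm 4.1 is integral only for surjective ρ_{E,p^∞}; with small image Kato's
bound holds after ⊗ℚ_p and the μ-parts are uncontrolled (84 X7 pairs with p ≥ 5 in the cell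
census).) [Kobayashi2003, Kato2004Asterisque, BurungaleSkinnerTianWan2024, Sprung2024]
#9 PublishedSignedInputs (support; verbatim the shared support item of route SignedLowerHalves,
split into ten BY-NAME children + proved glue 20273) — Wuthrich2014 Ш | Ш_an, Kobayashi2003 Thm 1.2
and Thm 4.1, BDKim2013 Cor 3.15, BurungaleKobayashiOta2023 Cor A.5, the two real-period/plus-period
unit statements, BCDT modularity, entireness of L(E, s), rank = analytic rank ≤ 1 (GZK).
[difficulty: provable-now / cite] [Wuthrich2014, Kobayashi2003, BDKim2013,
BurungaleKobayashiOta2023, BCDTJAMS2001]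
BANKED ASIDES (decls kept verbatim in the file for their importers; never staffed; history in the
route's git log and the seat folders HOME/bsd-wall-ss, -sbc-p1, -sbc-p2): #2
TwistPairGreenbergProductDivisibility (K1, gens 0–3, 20249: the product statement without the
splitting conjuncts; RUNG-A p505142 `twistPairProduct_of_thm924` = its (spl)-regime shadow) · #2′
TwistPairGreenbergProductDivisibilitySplit (K1′, gens 4–5, 20502: K1 + the three Heegner-splitting
conjuncts; ASIDE at rev 14′, superseded by #2″ = K1′ + «γ₁ canonical»; evidence: K1PRIME-LINE-MEMO
v1.2, sbc-p1 censuses g2–g4, landed frame-data/BCS-split helpers p514288 p523067 p523887 p526772, R3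
package rev15-R3/) · #3 SignedDescentFromGreenbergProduct (K2, 20250) · #3a
GreenbergFramesAtSupersingular (F, 20086; conditional helper p509495) · #3b
SignedDescentFromGreenbergFrames (K2R, 20087; split glue 20088 proved p505645) · #3d
SignedDescentFromCommonFrame (K2R′, 20417) · #3e SignedLowerDescentFromCommonFrame (K2R‴, 20213 —
K2R″ 20503 replaced at rev 12 —: the descent with GSF + PUB antecedents and K1′'s package′ VERBATIM
as ∀-binders; ASIDE at rev 14′, superseded by #3f which adds the two signed inputs and takes K1″ by
name; sbc-p2's landed v6 stubs p525141 p526821 p528542 p530884 p531951 and assembly p533062 carry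
over unchanged and close #3f) · #5 CornerX7AtThree (the p = 3 residual of the row leaf, 20251; not a
binder since rev 5) · #1 Assembly (20252, proved p503192; exempt).

TWO-LAYER PLAN. (gen 6.) `closes (K1″) (GSF) (SignedTwoVariableInputs) (K2R⁗) (K3) (PUB) (Sq) :
WAllCornerX7FiveLe` — Surj branch: Sq ∘ K2R⁗(thm41, thm12, Mod, Per, GSF, Inputs, K1″); ¬Surj
branch: K3; then the rank-0 / rank-1 consumers of `KobayashiMainConjecture` (BDKim2013 Cor 3.15 with
Pollack's L^± `pollack_exists_plusMinusPAdicLFunction_holds`; BurungaleKobayashiOta2023 Cor A.5)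
exactly as since rev 5 (certified: Sketch14.lean a688aeda46fcd00d rc 0 · 0 sorry, then `route check
--native`). K1″: no decomposition tracks its difficulty inside two layers (gen-5 note: the
abelian-tame / supercuspidal pocket split K1a/K1b of gens 0–3 does not — the unprinted ENGINE,
P-ordinary Hida theory + the Klingen–Eisenstein P-ordinary family on GU(3,1) over F ≠ ℚ (gap G1), is
pocket-independent; only the local triple products (gap G2; Hu 2017 covers tame types, wild ℓ = 2, 3
open) see the pocket; a split along «Theorem A over M» + Shapiro + L-factorisation only renames
K1″). The ONE typed split on offer is R3 (planner g3, rev15-R3/, certified rc 0 + BC7 CLEAN): K1″ ⇐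
GreenbergLowerHalfConj912 (BSTW Conj. 9.12 lower half for ONE supersingular newform over the common
frame, text A.sig = the single H912 text, director W-11 (e)) ∧ FD″ (frame data + the canonical
conjunct; PROVED from the tree: rev15-R3b/Sketch16.lean 1246817ae027fdda
`R3c.twistPairFrameDataCanonical_holds`, canonical pair p533780; and K1″ ⇐ A.sig ALONE:
`R3c.twistPairGreenbergProductDivisibilityCanonical_of_conj912`) — to be filed when the strategist
seat cstrat-20502 or the director calls it; it isolates the research statement per newform (the
product and the twist become bookkeeping) but does not lower it. K2R⁗: PROVED modulo the decl —
sbc-p2's LANDED assembly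
`Theorems.SignedBaseChangeK2RAssembly.signedLowerDescent_of_prop422_of_package` (p533062; every stub
of skeleton v6 landed: p525141 p526821 p528542 p530884 p531951) composed with the 6-line reorder
glue `k2r4_of_sbcp2Assembly` (rev14/Sketch15.lean f14ebc85c1490685, rc 0 · 0 sorry · std axioms)
closes it by ONE Theorems file right after this edit. STATUS of glue: Assembly 20252 (p503192),
PublishedSignedInputsGlue 20273 (p503254), K2-split glue 20088 (p505645), KobayashiSqueeze 20504
(p516518) CLOSED·proved. BC5/T3 witnesses unchanged: RUNG-A
(`Theorems/SignedBaseChangeK1Rung.twistPairProduct_of_thm924`, p505142; sibling (spl)-regime) and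
RUNG-B (`assembly_holds`).

KILL CRITERIA. A refutation of K1″ (an X7 pair with Surj, p ≥ 5, for which — for every admissible
(K, d, frame) — the product characteristic ideal is NOT contained in (G·G′) up to a nonzero
constant-in-T₂ factor: a positive anticyclotomic μ of ch·ch′ beyond that of G·G′, or an extra
divisor of ch·ch′ prime to every C(s)) closes the route
`refuted:TwistPairGreenbergProductDivisibilityCanonical` (the canonical-γ₁ conjunct cannot be the
culprit: Sketch14 `canonical_of_isTopGenerator`). K2R⁗ is refuted only by an X7 Surj pair, p ≥ 5,
where the Eisenstein half `KobayashiLowerDivisibility` fails for BOTH signs while K1″ and the two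
signed inputs stand — strictly harder to refute than Kobayashi's main conjecture itself; a
refutation of conjunct 2 of SignedTwoVariableInputs (the PRE package) as TYPED is a MIS-TYPING event
(class misstated ⇒ ty-1 re-types, this route restates #3g 1:1), not a kill. K3 refuted ⇒ the route
shrinks to the Surj slice (re-glue with `Surj W p` added to the leaf's hypotheses is NOT the leaf:
then retire `superseded` in favour of SignedLowerHalves' small-image line). If SignedLowerHalves
items 19001 + 19002 both close first, this route is moot for X7 (close `superseded --by
route-BirchSwinnertonDyer-SignedLowerHalves`).

NOT DECOMPOSED YET. The U(3,1)/F Eisenstein family itself (Klingen–Eisenstein on the quasi-split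
unitary group over F attached to M = F·K, the non-ordinary g_F and a Λ_M-adic CM character), its
Fourier–Jacobi non-vanishing mod p, the Galois argument (lattice construction) over M, and the
restriction Λ_M → Λ_K: all inside K1, deliberately not items (no tree carriers for three-variable
objects over M; D-0019 two layers). The choice of (K, d, F) (Chebotarev bookkeeping) is provable-now
glue inside K1's ∃. The μ = 0 input and the (P1)–(P3) package are now NAMED antecedents of K2R⁗
(#3g), no longer hidden inside the descent. ANATOMY OF K1″ = K1′ (gen 5; the rev-14′ conjunct is a
normalisation and changes nothing here): Theorem A = CLW22 Thm 8.2.1(1) transplanted along ℚ ↦ F =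
ℚ(√d), K ↦ M = F·K, π ↦ BC_F(π), D_{q,∞} ↦ the totally definite quaternion algebra B/F ramified
exactly at ∞₁∞₂ (exists since [F:ℚ] = 2 is even; π_F transfers by JL with no finite condition — CLW
use their non-split Steinberg prime q ONLY to build D, §5.4), Γ_K ↦ Γ_M ≅ ℤ_p³; inputs: (A1)
P-ordinary Hida theory over F — Marcil 2024 (arXiv:2409.03783) covers P-ordinary CUSPIDAL families
on unitary groups over CM 𝒦/𝒦⁺ ASSUMING the «standard conjectures of P-ordinary Hida theory»; the
Klingen part over F is unprinted (G1); (A2) p-local doubling: CLW §6–7 verbatim for p SPLIT in F;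
(A3) FJ p-primitivity: theta lifts in families (Lee 2024 arXiv:2406.12351), Ichino /F, Hsieh's mod-p
non-vanishing, local triple products at additive primes (Hu 2017; wild types open = G2); (A4)
lattice construction needs only irreducibility — no R = T / Gorenstein / Fujiwara (H1)–(H3)
counterpart for the R-localised statement K1′ asks; (A5) μ = 0 not needed by K1′ (slack s).
Provable-now helper (L1, Sketch7): Surj ∧ p ≥ 5 ⇒ ρ̄|G_M absolutely irreducible for every [M:ℚ] ≤ 4
(two transvections; upgrade of `irrK_framed_of_surj`).

CHEAPEST FALSIFIER. K1″ and K2R⁗ follow from the two-variable Greenberg main conjectures for E/K and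
E^(d)/K (s = 1) plus Kobayashi's theory and the two signed inputs, so numerics can only catch a
MIS-TYPING; the instruments for that are the vet stamps, the prover audits (K1-AUDIT-g2: cyclotomic
variable = outer T₁ ✓, Eisenstein direction ✓; sbc-p2 F1–F4′ ⇒ revs 10–12 and this rev 14′) and —
new at gen 6 — the DEGENERATE-INSTANCE test on every cited ∀-frame fact: the unguarded BCS25 Prop
4.2.2 typing v1 fell to the frame (Ω, δ, LK, G) = (0, 0, 0, 0)
(`prop422_grHalf_hasUnitContent_minus.false_of_instance`); K1″'s frame clause and #3g conjunct 1
carry `Ω ≠ 0` and GSF produces Ω ≠ 0. The ONE cheap check to run first on the new package is the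
same degenerate-instance audit of #3g conjunct 2 (the PRE binder): its premises carry Ω ≠ 0 and a
genuine `IsKatzMeasure₂`/`IsGreenbergLFunctionAnyRoot₂` frame, neither constructible in-tree without
the Katz / BSTW existence facts, so a junk-instance refutation should be impossible — a refuter
confirms by trying LK with vanishing values and G = 0 over a frame with Ω ≠ 0 (if `IsKatzMeasure₂`
admitted such an LK, (P1) + (P3) would force L^ε(f)·L^ε(f₂) = 0 or Char(X_Gr) = 0; then class
misstated, repair inside the PRE binder by ty-1 and a 1:1 restate of #3g here). RUNG-C (kit batch on
μ/λ of Pollack's L_p^±) stays RETIRED (RUNGC-NOTE-v1: pre-answered by Cremona's allbsd; no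
implication either way with the anticyclotomic-branch μ). The decisive LITERATURE checks behind K1″
were run 2026-08-27 and PASSED: F1 — CLW22 use the K-non-split prime q only through the definite
datum D_{q,∞} (§5.4), so the totally definite B/F replacement is well-aimed; F2 — BCS25's «p inert
in F» is not forced by its source (Wan15 Thm 4: p unramified in F). Standing refutation target: one
X7 Surj pair, p ≥ 5, for which BOTH signed Kobayashi lower divisibilities fail refutes K2R⁗ ∘ K1″.
BC5/T3 witnesses: RUNG-A (p505142) and RUNG-B (p503192) stand.

NUMBERS. x7census.tsv (cell bsd-wall, N < 5·10⁵ S-b register): 7 165 X7 (class, p) pairs; p ≥ 5: 3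
848 (rank 0: 568, rank 1: 3 280; Surj 3 764, non-Surj 84; no multiplicative prime at all: 28) = the
slice this route closes; p = 3: 3 317 (leaf `WAllCornerX7AtThree`, aside R); «open-ish» p ≥ 5 after
the cell's existing lines: 1 098. BSTW Thm 1.24 needs (spl) [arXiv:2409.01350 p. 73]; Wan ss IMC
needs N square-free + a non-split ℓ | N [arXiv:1411.6352 p. 4, p. 9]; BCS25 Prop 5.2.1 is ordinary,
p ≥ 5 [arXiv:2405.00270 p. 9]; Lv–Xie period comparison is ordinary, p ≥ 7 [arXiv:2512.08599 Thm
1.2].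

DEFINITION REQUESTS. None: every constant elaborates (Sketch.lean, Sketch14.lean rc 0).
Three-variable carriers over M = F·K (Λ_M, X_Gr over M_∞, L_p(g_F/M)) are deliberately NOT requested
— K1 is typed by its ℚ/K-shadow. (Gen 5: re-examined after sbc-p1's repair proposal R1 «typed
supersingular base-change Eisenstein divisibility binder» — still NOT requested: by Shapiro the
M-level statement in K-currency is K1′ itself; Marcil 2024's P-ordinary framework on unitary groups
over general CM 𝒦/𝒦⁺ is noted as the natural carrier should a Literature typing programme for
three-variable objects ever be opened by the director.)

Novelty: Searches (2026-08-27): corpus `lit search --hybrid "base change real quadratic Iwasawa main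
conjecture supersingular elliptic curve"` (10 docs, none on point: Kriz 2021, Coates–Greenberg
volumes); `lit vsearch "IMC for non-ordinary Hilbert modular forms … U(3,1)"` (10, none on point);
`lit search "Iwasawa main conjecture Hilbert modular forms" --kind paper` (12 local:
arxiv-2006.14491 LZ20, doi-10-4171-cmh-255, arxiv-1909.12374, arxiv-1909.10162, wan2015; remote
arXiv/zbMATH/Crossref 34 merged, OpenAlex/S2 429); `lit search "non-ordinary Hilbert modular forms
Iwasawa signed Selmer supersingular totally real"` (0 conjunctive; relaxed:
doi-10-1016-j-jalgebra-2011-04-033, doi-10-1016-j-jnt-2010-09-005); galaxy `--star all`: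
"non-ordinary Hilbert modular|nonordinary Hilbert modular|supersingular Hilbert modular" 0, "base
change and Iwasawa|Base change and Iwasawa|via base change to a real quadratic" 0, "main conjecture
for Hilbert modular|…" pdf 2 (off point), "signed Selmer groups over totally real|plus and minus
Selmer groups of Hilbert|Kobayashi's main conjecture" 0, "GU(3,1)|U(3,1)|U(3, 1)" 30 substring-noise
hits (none mathematical on point), "plus/minus main conjecture|signed main conjecture|triple product
period" pdf 2 ([galaxy:pdf:-2774205897228378480] BLLV 2019, [galaxy:pdf:-918875354182355320]
Rockwood thesis); `ledger negatives --problem BirchSwinnertonDyer` (1, unrelated); tree: `lean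
search` BCS25/BSTW decls (prop521, thm924).
Nearest prior art found: BurungaleCastel  [refs: 1411.6352, 2512.08599, arxiv-2006.14491, doi-10-4171-cmh-255, arxiv-1909.12374, arxiv-1909.10162, doi-10-1016-j-jalgebra-2011-04-033, doi-10-1016-j-jnt-2010-09-005, paper-arxiv-2405.00270, paper-wan2015-, paper-arxiv-2409.01350, paper-arxiv-1411.6352, paper-arxiv-2512.08599, BurungaleCastellaSkinner2025, BurungaleSkinnerTianWan2024]

Barriers (technique_class: iwasawa-main-conjecture, eisenstein-congruences, base-change): - technique_class: iwasawa-main-conjecture, eisenstein-congruences, base-change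
- Literature.Barriers.BirchSwinnertonDyer.PAdicHeightBarrier: outside — K1/K2/K3 are main-conjecture
(characteristic-ideal) statements with no p-adic height; the rank-1 leg runs through the landed
consumer `X7.bsdp_of_kobayashiMainConjecture_of_corA5_of_analyticRank_eq_one`
(BurungaleKobayashiOta2023 Cor A.5 + GZK), where non-degeneracy on a rank-1 group is a consequence
of Heegner non-torsion, not an input.
- Literature.Barriers.BirchSwinnertonDyer.ExceptionalZeroBarrier: outside — p is a prime of GOOD
supersingular reduction (ClassX7 ⊂ GoodSS), the barrier's `IsSplitMultPAdicLFunctionOf` hypothesis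
(split multiplicative p) is violated.
- Literature.Barriers.BirchSwinnertonDyer.ExceptionalZeroBarrierNarrow: outside — the narrow form
blocks identities using the Mazur–Tate–Teitelbaum `L_p(E,T)` at a SPLIT MULTIPLICATIVE p; here p is
a prime of good supersingular reduction and the p-adic L-functions in play are Pollack's L_p^± /
BSTW's Greenberg-type L_p^Gr over K, which have no exceptional zero at good p.
- Literature.Barriers.BirchSwinnertonDyer.EisensteinMuBarrier: outside — X7 at odd p has E[p]
irreducible (`Rank1Residual.ClassX7.irr`), the barrier quantifies over residually REDUCIBLE p.
- Literature.Barriers.BirchSwinnertonDyer.ReducibleAnticyclotomicAtBadP: outside — good p and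
irreducible E[p]; the barrier's scope is Eisenstein p of bad reduction.
- Literature.Barriers.BirchSwinnertonDyer.Ant

History (route lifecycle, newest last):
- 2026-08-27T08:10:32Z · AUTO-CRUX (edit): SignedDescentFromCommonFrame — hypotheses of the deciding theorem that nothing in the route derives are cruxes (planner-bsd-wall-ss-g2-0)
- 2026-08-27T08:54:15Z · AUTO-CRUX (edit): SignedLowerDescentFromCommonFrame, KobayashiSqueeze — hypotheses of the deciding theorem that nothing in the route derives are cruxes (planner-bsd-wall-ss-g2-0)
- 2026-08-27T09:37:50Z · rev 12: restated SignedLowerDescentFromCommonFrame (stmt-BirchSwinnertonDyer-20503) — rev 12 = director FREEZE EXCEPTION #1 (INBOX 09:20:49Z; sbc-p2 F3 09:19:44Z: binder omission, misstated class): K2R″ → K2R‴ — the two PUB antecedents (conjunct (planner-bsd-wall-ss-g3-0)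
- 2026-08-27T10:38:45Z · rev 13: informal re-worded for TwistPairGreenbergProductDivisibilitySplit (planner-bsd-wall-ss-g3-0)
- 2026-08-27T14:49:28Z · AUTO-CRUX (edit): SignedLowerDescentFromTwoVariablePackage — hypotheses of the deciding theorem that nothing in the route derives are cruxes (planner-bsd-wall-ss-g6-0)
- 2026-08-27T16:16:35Z · rev 20: restated AnticyclotomicEisensteinDivisibility (stmt-BirchSwinnertonDyer-20576) — render-compat restate (tenure ss g6, W-20): antecedent SignedTwoVariableInputs written BY VALUE (its two named-fact conjuncts) — δ-equal proposition, NO change (planner-bsd-wall-ss-g6-0)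
- 2026-08-27T16:21:09Z · rev 21: restated TwoVariableEulerSystemDivisibility (stmt-BirchSwinnertonDyer-20577) — render-compat restate (tenure ss g6, W-20): antecedent SignedTwoVariableInputs written BY VALUE — δ-equal proposition, NO change of meaning, same decl name/kind (planner-bsd-wall-ss-g6-0)
- 2026-08-27T16:29:58Z · rev 22: dropped stmt-BirchSwinnertonDyer-20576, stmt-BirchSwinnertonDyer-20577 — drop the two REPLACED records (closed at the rev-20/21 render-compat restates; live successors 20727/20728 keep the same decl names) — their superseded texts (a (planner-bsd-wall-ss-g6-0)

sub-problem: BirchSwinnertonDyer · status: open · opened planner-bsd-wall-ss-g0-0 2026-08-27T05:15:40Z · rev 22 · ledger route-BirchSwinnertonDyer-SignedBaseChange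
GENERATED by the gate from the ledger (D-0016/17). Provers cite these decls: `theorem foo : Summit.BirchSwinnertonDyer.BirchSwinnertonDyer.Theses.SignedBaseChange.<Decl> := …` in Summits/BirchSwinnertonDyer/BirchSwinnertonDyer/Theorems/<Name>.lean.
-/

namespace Summit.BirchSwinnertonDyer.BirchSwinnertonDyer.Theses.SignedBaseChange

open scoped BigOperators Topology Manifold Classical MeasureTheory ProbabilityTheory Matrix InnerProductSpace ComplexConjugate ContinuousMap
open Filter Set Function TopologicalSpace MeasureTheory

attribute [summit_statement] _root_.BirchSwinnertonDyer
attribute [summit_statement] _root_.Summit.BirchSwinnertonDyer.WAllCornerX7FiveLe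

open Literature

/-- item stmt-BirchSwinnertonDyer-19002 · crux · rank 4 · open · by planner
why it might fail: Kobayashi2003 Thm 4.1 is integral only for surjective ρ_{E,p^∞}; with small image Kato's bound holds after ⊗ℚ_p and the μ-parts of ch(X^±) vs (L_p^±) are uncontrolled (84 X7 pairs with p ≥ 5 in the cell census).
sources: Kobayashi2003, Kato2004Asterisque, BurungaleSkinnerTianWan2024, Sprung2024
[crux] X_B2 (small image) — for every non-semistable non-CM `E/ℚ`, every odd good supersingular `p`
with `a_p = 0` and `ρ̄_(E,p)` NOT surjective, there is a sign `ε` for which Kobayashi's signed main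
conjecture holds as an EQUALITY (typed `KobayashiMainConjecture W p ε`); the route needs the
equality because Kobayashi's Thm. 4.1 (Kato divisibility) is integral only for surjective image.
[difficulty: open-problem] -/
@[route_item "route-BirchSwinnertonDyer-SignedBaseChange", crux]
def KobayashiMainConjectureSmallImage : Prop :=
  ∀ (W : WeierstrassCurve ℚ) [W.IsElliptic] [W.IsGloballyMinimal] (p : ℕ) [Fact p.Prime], p ≠ 2 → Literature.NumberTheory.EllipticCurves.Rank1Residual.ClassX7 W p → ¬ W.HasCM → W.frobeniusTrace p = 0 → ¬ Literature.NumberTheory.EllipticCurves.Rank1Residual.Surj W p → ∃ ε : ℤˣ, Summit.BirchSwinnertonDyer.Rank1Residual.Supersingular.KobayashiMainConjecture W p ε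

/-- item stmt-BirchSwinnertonDyer-20504 · crux (kind.auto-crux: conjecture-grade) · rank 9 · closed · proved by Summit.BirchSwinnertonDyer.BirchSwinnertonDyer.Theorems.SignedBaseChangeSqueezeGlue.kobayashiSqueeze_holds (planner) · by planner
why it might fail: auto-crux — conjecture-grade (statement references the registered conjecture Summit.BirchSwinnertonDyer.Rank1Residual.Supersingular.KobayashiMainConje): the deciding theorem assumes it and nothing in the route derives it, so it is a bet, not glue
sources: closes-admissibility
[support · glue] the Surj squeeze from the Eisenstein half to Kobayashi's main conjecture: thm12
(X^ε torsion) + thm41 (Kato half, L^ε ∈ (g) under Surj) + ord_p ϖ = 0 (period unit, supplied in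
`closes` from PUB's conjunct realPeriodRat_eq_unit_mul_plusPeriod via
padicValRat_periodRatio_eq_zero_of_five_le at an X7 pair) + KobayashiLowerDivisibility ⇒
KobayashiMainConjecture W p ε. PROVED in the tree:
Theorems.SignedBaseChangeK2RSqueeze.kobayashiMainConjecture_of_lowerDivisibility_of_periodUnit
(p512698, bsd-wall-sbc-p2); closes by a one-line proposal importing that file. Sources:
Kobayashi2003 Thm 1.2/4.1; GreenbergVatsal2000 §3 Rem 3.4. -/
@[route_item "route-BirchSwinnertonDyer-SignedBaseChange", crux]
def KobayashiSqueeze : Prop :=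
  Literature.NumberTheory.EllipticCurves.Kobayashi2003.thm12_signedSelmerDual_finite_torsion → Literature.NumberTheory.EllipticCurves.Kobayashi2003.thm41_signedCharIdeal_divisibility → ∀ (W : WeierstrassCurve ℚ) [W.IsElliptic] [W.IsGloballyMinimal] (p : ℕ) [Fact p.Prime], p ≠ 2 → W.HasGoodReductionAtPrime p → W.frobeniusTrace p = 0 → Literature.NumberTheory.EllipticCurves.Rank1Residual.Surj W p → (∀ {N : ℕ} [NeZero N] (f : CuspForm (CongruenceSubgroup.Gamma0 N) 2), Literature.NumberTheory.EllipticCurves.ModularForms.IsNewformOf W f → ∀ ϖ : ℚ, (ϖ : ℝ) * W.realPeriodRat = Literature.NumberTheory.EllipticCurves.ModularForms.plusPeriod f → padicValRat p ϖ = 0) → ∀ ε : ℤˣ, Summit.BirchSwinnertonDyer.Rank1Residual.Supersingular.KobayashiLowerDivisibility W p ε → Summit.BirchSwinnertonDyer.Rank1Residual.Supersingular.KobayashiMainConjecture W p ε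

-- `KobayashiSqueeze` holds: proved by `Summit.BirchSwinnertonDyer.BirchSwinnertonDyer.Theorems.SignedBaseChangeSqueezeGlue.kobayashiSqueeze_holds` (its module imports this route file, so no `_holds` link can be stated here).

/-- item stmt-BirchSwinnertonDyer-20249 · aside · rank 2 · open · by planner
why it might fail: needs a Greenberg-type U(3,1)/F Eisenstein family for the NON-ORDINARY g_F plus Fourier–Jacobi local triple-product periods at additive primes split in M/F; for supercuspidal/wild types (ℓ = 2, 3; e ∈ {3,4,6,8,12,24}) these are computed nowhere in print.
sources: BurungaleCastellaSkinner2025, Wan2015HilbertIMC, BurungaleSkinnerTianWan2024, CastellaLiuWan2022, Wan2020RankinSelbergIMC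
[crux] (K1) Modularity (BCDT, named fact) ⇒ for every globally minimal elliptic W/ℚ, p ≥ 5, ClassX7
W p, ρ̄ surjective: there exist an imaginary quadratic K with p = v·v̄ split, (N, D_K) = 1, E[p]|G_K
abs. irreducible, cyclotomic/anticyclotomic ℤ_p-extensions κ₁, κ₂, the newform f of W, a squarefree
d > 1 ramified only at primes q ∤ pN·D_K, the minimal model W' of the twist W^(d) with newform f',
such that for every Katz-normalised pair of Greenberg p-adic L-functions G, G' of f, f' over K (BSTW
normalisation `IsGreenbergLFunctionAnyRoot₂`) there is s ∈ Λ^cyc, s ≠ 0, with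
s·ch(X_Gr₂(W/K))·ch(X_Gr₂(W'/K)) ⊆ (G·G') in Λ_K^ur — the BSTW Thm 9.24 conclusion for the PRODUCT,
with NO square-free and NO (spl) hypothesis. [difficulty: XL] -/
@[route_item "route-BirchSwinnertonDyer-SignedBaseChange"]
def TwistPairGreenbergProductDivisibility : Prop :=
  Literature.NumberTheory.EllipticCurves.ModularForms.nonempty_modularParametrizationData → ∀ (W : WeierstrassCurve ℚ) [W.IsElliptic] [W.IsGloballyMinimal] (p : ℕ) [Fact p.Prime], 5 ≤ p → Literature.NumberTheory.EllipticCurves.Rank1Residual.ClassX7 W p → Literature.NumberTheory.EllipticCurves.Rank1Residual.Surj W p → ∃ (K : Type) (_ : Field K) (_ : NumberField K) (ι : PadicAlgCl p ≃+* ℂ) (v vbar : IsDedekindDomain.HeightOneSpectrum (NumberField.RingOfIntegers K)) (κ₁ κ₂ : Literature.NumberTheory.EllipticCurves.ZpExtension K p) (γ₁ γ₂ : Field.absoluteGaloisGroup K) (_ : Fact (Literature.NumberTheory.EllipticCurves.ZpExtension.IsTopGeneratorPair κ₁ κ₂ γ₁ γ₂)) (_ : NeZero (NumberField.discr K).natAbs)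 (N : ℕ) (_ : NeZero N) (f : CuspForm (CongruenceSubgroup.Gamma0 N) 2) (d : ℤ) (W' : WeierstrassCurve ℚ) (_ : W'.IsElliptic) (_ : W'.IsGloballyMinimal) (C : WeierstrassCurve.VariableChange ℚ) (N' : ℕ) (_ : NeZero N') (f' : CuspForm (CongruenceSubgroup.Gamma0 N') 2), Literature.NumberTheory.EllipticCurves.ModularForms.IsNewformOf W f ∧ (N : ℤ) = W.conductorNorm ℤ ∧ Literature.NumberTheory.EllipticCurves.ModularForms.IsNewformOf W' f' ∧ (N' : ℤ) = W'.conductorNorm ℤ ∧ Squarefree d ∧ 1 < d ∧ (∀ q : ℕ, q.Prime → Literature.NumberTheory.EllipticCurves.BurungaleSkinnerTianWan2024.RamifiedInQuadratic d q → q ≠ p ∧ ¬ q ∣ N ∧ ¬ (q : ℤ) ∣ NumberField.discr K) ∧ C • W' = W.quadraticTwist (d : ℚ) ∧ Literature.NumberTheory.EllipticCurves.IsImaginaryQuadratic K ∧ ((Ideal.span {(p : ℤ)}).primesOver (NumberField.RingOfIntegers K)).ncard = 2 ∧ ((p : ℕ) : NumberField.RingOfIntegers K) ∈ v.asIdeal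 ∧ ((p : ℕ) : NumberField.RingOfIntegers K) ∈ vbar.asIdeal ∧ vbar ≠ v ∧ (∀ (w : NumberField.InfinitePlace K) (k : NumberField.RingOfIntegers K), k ∈ v.asIdeal ↔ ‖ι.symm (w.embedding (k : K))‖ < 1) ∧ IsCoprime (N : ℤ) (NumberField.discr K) ∧ (∀ ρ : Literature.NumberTheory.GaloisRepresentations.ModPGaloisRep K (ZMod p) 2, (W.baseChange K).IsTorsionGaloisRep p ρ → Literature.NumberTheory.GaloisRepresentations.FramedRep.IsAbsolutelyIrreducible ρ) ∧ κ₁.IsCyclotomic ∧ κ₂.IsAnticyclotomic ∧ ∀ (Ω δ : ℂ) (Ωp : (Literature.NumberTheory.EllipticCurves.unrIntegers p)ˣ) (LK G G' : PowerSeries (PowerSeries (PadicComplexInt p))), Ω ≠ 0 → (δ ^ 2 = (NumberField.discr K : ℂ) ∨ δ ^ 2 = -(NumberField.discr K : ℂ)) → Literature.NumberTheory.EllipticCurves.IsKatzMeasure₂ ι v vbar ∅ κ₁ κ₂ γ₁⁻¹ γ₂⁻¹ 1 Ω δ ((Ωp : Literature.NumberTheory.EllipticCurves.unrIntegers p) :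 PadicComplex p) LK → Literature.NumberTheory.EllipticCurves.IsGreenbergLFunctionAnyRoot₂ ι v vbar κ₁ κ₂ γ₁⁻¹ γ₂⁻¹ f (NumberField.discr K).natAbs (NumberField.classNumber K) LK G → Literature.NumberTheory.EllipticCurves.IsGreenbergLFunctionAnyRoot₂ ι v vbar κ₁ κ₂ γ₁⁻¹ γ₂⁻¹ f' (NumberField.discr K).natAbs (NumberField.classNumber K) LK G' → ∀ J : ℤ_[p] →+* PadicComplexInt p, (∀ x : ℤ_[p], ((J x : PadicComplexInt p) : PadicComplex p) = ((x : ℚ_[p]) : PadicComplex p)) → ∃ s : PowerSeries (PadicComplexInt p), s ≠ 0 ∧ Ideal.span {PowerSeries.map (PowerSeries.C (R := PadicComplexInt p)) s} * ((WeierstrassCurve.XGr₂.charIdeal (W.baseChange K) p κ₁ κ₂ vbar γ₁ γ₂).map (Literature.NumberTheory.EllipticCurves.IwasawaAlgebra₂.toUnr₂ p J) * (WeierstrassCurve.XGr₂.charIdeal (W'.baseChange K) p κ₁ κ₂ vbar γ₁ γ₂).map (Literature.NumberTheory.EllipticCurves.IwasawaAlgebra₂.toUnr₂ p J)) ≤ Ideal.span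 {G * G'}

/-- item stmt-BirchSwinnertonDyer-20502 · aside · rank 2 · open · by planner
[crux] (K1′ = K1 20249 with the Heegner splitting conjunct, prover census F2 of bsd-wall-sbc-p2) for
p ≥ 5, an X7 pair (E, p) with surjective ρ̄ admits an imaginary quadratic K with p split AND every
prime ℓ ∣ N·N′ split (N′ = conductor of the twist E^(d)), a real quadratic twist E^(d) (d > 1
square-free, ramified away from p·N·D_K), a BSTW common Katz frame, and the two-variable GREENBERG
divisibility for the PRODUCT ch(X_Gr(E/K_∞))·ch(X_Gr(E^(d)/K_∞)) ⊆ (G·G′) up to a non-zero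
Λ^cyc-factor s, uniformly over the frames (LK, G, G′) — package text = K1's verbatim plus the three
formal conjuncts `∀ ℓ prime, ℓ ∣ N → #primesOver(ℓ) = 2`, `∀ ℓ prime, (ℓ:ℤ) ∣ d → #primesOver(ℓ) =
2`, `#primesOver(2) = 2` (together = «every ℓ ∣ N·N′ splits in K», since N′ ∣ 2^8·N·d²; sbc-p1
K1-AUDIT-g2 NOTE A). With Heegner-K each factor E/K, E^(d)/K has sign −1 and the base change to F =
ℚ(√d) has sign +1: exactly the definite n⁻ = 1 datum of the thesis; the conjunct is what K2R″'s
de-localisation consumes (μ(𝓛_p^{ac}) = 0 under classical Heegner). K chosen by CRT/Dirichlet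
(finitely many split conditions), irr_K automatic from Surj for p ≥ 5. WHY IT MIGHT FAIL: as K1 —
K1′ is the K-currency shadow of ON -/
@[route_item "route-BirchSwinnertonDyer-SignedBaseChange", crux]
def TwistPairGreenbergProductDivisibilitySplit : Prop :=
  Literature.NumberTheory.EllipticCurves.ModularForms.nonempty_modularParametrizationData → ∀ (W : WeierstrassCurve ℚ) [W.IsElliptic] [W.IsGloballyMinimal] (p : ℕ) [Fact p.Prime], 5 ≤ p → Literature.NumberTheory.EllipticCurves.Rank1Residual.ClassX7 W p → Literature.NumberTheory.EllipticCurves.Rank1Residual.Surj W p → ∃ (K : Type) (_ : Field K) (_ : NumberField K) (ι : PadicAlgCl p ≃+* ℂ) (v vbar : IsDedekindDomain.HeightOneSpectrum (NumberField.RingOfIntegers K)) (κ₁ κ₂ : Literature.NumberTheory.EllipticCurves.ZpExtension K p) (γ₁ γ₂ : Field.absoluteGaloisGroup K) (_ : Fact (Literature.NumberTheory.EllipticCurves.ZpExtension.IsTopGeneratorPair κ₁ κ₂ γ₁ γ₂)) (_ : NeZero (NumberField.discr K).natAbs) (N : ℕ) (_ : NeZero N) (f : CuspForm (CongruenceSubgroup.Gamma0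 N) 2) (d : ℤ) (W' : WeierstrassCurve ℚ) (_ : W'.IsElliptic) (_ : W'.IsGloballyMinimal) (C : WeierstrassCurve.VariableChange ℚ) (N' : ℕ) (_ : NeZero N') (f' : CuspForm (CongruenceSubgroup.Gamma0 N') 2), Literature.NumberTheory.EllipticCurves.ModularForms.IsNewformOf W f ∧ (N : ℤ) = W.conductorNorm ℤ ∧ Literature.NumberTheory.EllipticCurves.ModularForms.IsNewformOf W' f' ∧ (N' : ℤ) = W'.conductorNorm ℤ ∧ Squarefree d ∧ 1 < d ∧ (∀ q : ℕ, q.Prime → Literature.NumberTheory.EllipticCurves.BurungaleSkinnerTianWan2024.RamifiedInQuadratic d q → q ≠ p ∧ ¬ q ∣ N ∧ ¬ (q : ℤ) ∣ NumberField.discr K) ∧ C • W' = W.quadraticTwist (d : ℚ) ∧ Literature.NumberTheory.EllipticCurves.IsImaginaryQuadratic K ∧ ((Ideal.span {(p : ℤ)}).primesOver (NumberField.RingOfIntegers K)).ncard = 2 ∧ ((p : ℕ) : NumberField.RingOfIntegers K) ∈ v.asIdeal ∧ ((p : ℕ) : NumberField.RingOfIntegers K) ∈ vbar.asIdeal ∧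 vbar ≠ v ∧ (∀ (w : NumberField.InfinitePlace K) (k : NumberField.RingOfIntegers K), k ∈ v.asIdeal ↔ ‖ι.symm (w.embedding (k : K))‖ < 1) ∧ IsCoprime (N : ℤ) (NumberField.discr K) ∧ (∀ ℓ : ℕ, ℓ.Prime → ℓ ∣ N → ((Ideal.span {(ℓ : ℤ)}).primesOver (NumberField.RingOfIntegers K)).ncard = 2) ∧ (∀ ℓ : ℕ, ℓ.Prime → (ℓ : ℤ) ∣ d → ((Ideal.span {(ℓ : ℤ)}).primesOver (NumberField.RingOfIntegers K)).ncard = 2) ∧ ((Ideal.span {(2 : ℤ)}).primesOver (NumberField.RingOfIntegers K)).ncard = 2 ∧ (∀ ρ : Literature.NumberTheory.GaloisRepresentations.ModPGaloisRep K (ZMod p) 2, (W.baseChange K).IsTorsionGaloisRep p ρ → Literature.NumberTheory.GaloisRepresentations.FramedRep.IsAbsolutelyIrreducible ρ) ∧ κ₁.IsCyclotomic ∧ κ₂.IsAnticyclotomic ∧ ∀ (Ω δ : ℂ) (Ωp : (Literature.NumberTheory.EllipticCurves.unrIntegers p)ˣ) (LK G G' : PowerSeries (PowerSeries (PadicComplexInt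 p))), Ω ≠ 0 → (δ ^ 2 = (NumberField.discr K : ℂ) ∨ δ ^ 2 = -(NumberField.discr K : ℂ)) → Literature.NumberTheory.EllipticCurves.IsKatzMeasure₂ ι v vbar ∅ κ₁ κ₂ γ₁⁻¹ γ₂⁻¹ 1 Ω δ ((Ωp : Literature.NumberTheory.EllipticCurves.unrIntegers p) : PadicComplex p) LK → Literature.NumberTheory.EllipticCurves.IsGreenbergLFunctionAnyRoot₂ ι v vbar κ₁ κ₂ γ₁⁻¹ γ₂⁻¹ f (NumberField.discr K).natAbs (NumberField.classNumber K) LK G → Literature.NumberTheory.EllipticCurves.IsGreenbergLFunctionAnyRoot₂ ι v vbar κ₁ κ₂ γ₁⁻¹ γ₂⁻¹ f' (NumberField.discr K).natAbs (NumberField.classNumber K) LK G' → ∀ J : ℤ_[p] →+* PadicComplexInt p, (∀ x : ℤ_[p], ((J x : PadicComplexInt p) : PadicComplex p) = ((x : ℚ_[p]) : PadicComplex p)) → ∃ s : PowerSeries (PadicComplexInt p), s ≠ 0 ∧ Ideal.span {PowerSeries.map (PowerSeries.C (R := PadicComplexInt p)) s} * ((WeierstrassCurve.XGr₂.charIdeal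 (W.baseChange K) p κ₁ κ₂ vbar γ₁ γ₂).map (Literature.NumberTheory.EllipticCurves.IwasawaAlgebra₂.toUnr₂ p J) * (WeierstrassCurve.XGr₂.charIdeal (W'.baseChange K) p κ₁ κ₂ vbar γ₁ γ₂).map (Literature.NumberTheory.EllipticCurves.IwasawaAlgebra₂.toUnr₂ p J)) ≤ Ideal.span {G * G'}

/-- item stmt-BirchSwinnertonDyer-20250 · aside · rank 3 · SPLIT (gen 1) into GreenbergFramesAtSupersingular, SignedDescentFromGreenbergFrames + glue SignedDescentFromGreenbergProductOfFrames · direct attempts still welcome (low priority) · by planner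
why it might fail: K1 gives only the PRODUCT up to a Λ^cyc-factor s; splitting it needs μ(L_p^Gr) = 0 for f AND f' (Hsieh/Burungale type), the Kato bound for all four ℚ-pieces at once, and a canonical-period comparison under base change that is printed only for ORDINARY p (Lv–Xie 2025, arXiv:2512.08599 Thm 1.2).
sources: Kobayashi2003, BDKim2013, BurungaleSkinnerTianWan2024, arXiv:2512.08599, Wan2015HilbertIMC
[crux] (K2) Kobayashi2003 Thm 4.1 (Kato-side ± divisibility, integral under Surj) → Kobayashi2003
Thm 1.2 (± control / torsionness) → for p ≥ 5, ClassX7, Surj: the K1 package (product Greenberg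
divisibility up to s ∈ Λ^cyc \ 0 for (W, W^(d)) over K) implies Kobayashi's main conjecture
`KobayashiMainConjecture W p ε` for BOTH signs ε. [deps: TwistPairGreenbergProductDivisibility]
[difficulty: L] -/
@[route_item "route-BirchSwinnertonDyer-SignedBaseChange"]
def SignedDescentFromGreenbergProduct : Prop :=
  Literature.NumberTheory.EllipticCurves.Kobayashi2003.thm41_signedCharIdeal_divisibility → Literature.NumberTheory.EllipticCurves.Kobayashi2003.thm12_signedSelmerDual_finite_torsion → ∀ (W : WeierstrassCurve ℚ) [W.IsElliptic] [W.IsGloballyMinimal] (p : ℕ) [Fact p.Prime], 5 ≤ p → Literature.NumberTheory.EllipticCurves.Rank1Residual.ClassX7 W p → Literature.NumberTheory.EllipticCurves.Rank1Residual.Surj W p → (∃ (K : Type) (_ : Field K) (_ : NumberField K) (ι : PadicAlgCl p ≃+* ℂ) (v vbar : IsDedekindDomain.HeightOneSpectrum (NumberField.RingOfIntegers K)) (κ₁ κ₂ : Literature.NumberTheory.EllipticCurves.ZpExtension K p) (γ₁ γ₂ : Field.absoluteGaloisGroup K) (_ : Fact (Literature.NumberTheory.EllipticCurves.ZpExtension.IsTopGeneratorPair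 κ₁ κ₂ γ₁ γ₂)) (_ : NeZero (NumberField.discr K).natAbs) (N : ℕ) (_ : NeZero N) (f : CuspForm (CongruenceSubgroup.Gamma0 N) 2) (d : ℤ) (W' : WeierstrassCurve ℚ) (_ : W'.IsElliptic) (_ : W'.IsGloballyMinimal) (C : WeierstrassCurve.VariableChange ℚ) (N' : ℕ) (_ : NeZero N') (f' : CuspForm (CongruenceSubgroup.Gamma0 N') 2), Literature.NumberTheory.EllipticCurves.ModularForms.IsNewformOf W f ∧ (N : ℤ) = W.conductorNorm ℤ ∧ Literature.NumberTheory.EllipticCurves.ModularForms.IsNewformOf W' f' ∧ (N' : ℤ) = W'.conductorNorm ℤ ∧ Squarefree d ∧ 1 < d ∧ (∀ q : ℕ, q.Prime → Literature.NumberTheory.EllipticCurves.BurungaleSkinnerTianWan2024.RamifiedInQuadratic d q → q ≠ p ∧ ¬ q ∣ N ∧ ¬ (q : ℤ) ∣ NumberField.discr K) ∧ C • W' = W.quadraticTwist (d : ℚ) ∧ Literature.NumberTheory.EllipticCurves.IsImaginaryQuadratic K ∧ ((Ideal.span {(p : ℤ)}).primesOver (NumberField.RingOfIntegers K)).ncard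 = 2 ∧ ((p : ℕ) : NumberField.RingOfIntegers K) ∈ v.asIdeal ∧ ((p : ℕ) : NumberField.RingOfIntegers K) ∈ vbar.asIdeal ∧ vbar ≠ v ∧ (∀ (w : NumberField.InfinitePlace K) (k : NumberField.RingOfIntegers K), k ∈ v.asIdeal ↔ ‖ι.symm (w.embedding (k : K))‖ < 1) ∧ IsCoprime (N : ℤ) (NumberField.discr K) ∧ (∀ ρ : Literature.NumberTheory.GaloisRepresentations.ModPGaloisRep K (ZMod p) 2, (W.baseChange K).IsTorsionGaloisRep p ρ → Literature.NumberTheory.GaloisRepresentations.FramedRep.IsAbsolutelyIrreducible ρ) ∧ κ₁.IsCyclotomic ∧ κ₂.IsAnticyclotomic ∧ ∀ (Ω δ : ℂ) (Ωp : (Literature.NumberTheory.EllipticCurves.unrIntegers p)ˣ) (LK G G' : PowerSeries (PowerSeries (PadicComplexInt p))), Ω ≠ 0 → (δ ^ 2 = (NumberField.discr K : ℂ) ∨ δ ^ 2 = -(NumberField.discr K : ℂ)) → Literature.NumberTheory.EllipticCurves.IsKatzMeasure₂ ι v vbar ∅ κ₁ κ₂ γ₁⁻¹ γ₂⁻¹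 1 Ω δ ((Ωp : Literature.NumberTheory.EllipticCurves.unrIntegers p) : PadicComplex p) LK → Literature.NumberTheory.EllipticCurves.IsGreenbergLFunctionAnyRoot₂ ι v vbar κ₁ κ₂ γ₁⁻¹ γ₂⁻¹ f (NumberField.discr K).natAbs (NumberField.classNumber K) LK G → Literature.NumberTheory.EllipticCurves.IsGreenbergLFunctionAnyRoot₂ ι v vbar κ₁ κ₂ γ₁⁻¹ γ₂⁻¹ f' (NumberField.discr K).natAbs (NumberField.classNumber K) LK G' → ∀ J : ℤ_[p] →+* PadicComplexInt p, (∀ x : ℤ_[p], ((J x : PadicComplexInt p) : PadicComplex p) = ((x : ℚ_[p]) : PadicComplex p)) → ∃ s : PowerSeries (PadicComplexInt p), s ≠ 0 ∧ Ideal.span {PowerSeries.map (PowerSeries.C (R := PadicComplexInt p)) s} * ((WeierstrassCurve.XGr₂.charIdeal (W.baseChange K) p κ₁ κ₂ vbar γ₁ γ₂).map (Literature.NumberTheory.EllipticCurves.IwasawaAlgebra₂.toUnr₂ p J) * (WeierstrassCurve.XGr₂.charIdeal (W'.baseChange K) p κ₁ κ₂ vbar γ₁ γ₂).map (Literature.NumberTheory.EllipticCurves.IwasawaAlgebra₂.toUnr₂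 p J)) ≤ Ideal.span {G * G'}) → ∀ ε : ℤˣ, Summit.BirchSwinnertonDyer.Rank1Residual.Supersingular.KobayashiMainConjecture W p ε

-- parent: SignedDescentFromGreenbergProduct · child (gen 1)
/--     item stmt-BirchSwinnertonDyer-20086 · aside · rank 301 · open
    parent: SignedDescentFromGreenbergProduct · by planner
    why it might fail: Integral 𝓛_p^Gr at NON-ORDINARY p rests on BSTW's two-variable zeta element + ERL II′ (Thm 5.11), unrefereed; refereed constructions (Wan2020, CLW2022) live in Λ_K^ur ⊗ Frac(Λ^cyc) only, and the frame's period/h_K normalisation is unchecked at supersingular p.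
    sources: BurungaleSkinnerTianWan2024, YanZhu2024MainConjNonCM, CastellaGrossiSkinner2025, deShalit1987, CastellaLiuWan2022, Wan2020RankinSelbergIMC
[crux] (F, construction half of K2) for a globally minimal E/ℚ with GOOD SUPERSINGULAR reduction at
p ≥ 5 (a_p = 0, p ∤ N), K imaginary quadratic with (ord) p = v·v̄ (v induced by ι), (N, D_K) = 1,
the cyclotomic/anticyclotomic ℤ_p²-tower with a generator pair: (a) a Katz frame (Ω ≠ 0, δ² = ±D_K,
Ω_p, LK with `IsKatzMeasure₂` at the inverse generators) EXISTS, and (b) over EVERY Katz frame there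
EXISTS an integral series G ∈ 𝒪_{ℂ_p}⟦T₁,T₂⟧ satisfying the reduction-type-free Greenberg value
frame `IsGreenbergLFunctionAnyRoot₂ … f … LK G` (G = 𝓛_p^Gr(E/K) = h_K·𝓛_𝔭(K)'·𝓛_p^II). The
supersingular analogue of Yan–Zhu Thm 3.9
(`YanZhu2026.thm39_def311_exists_isGreenbergLFunctionAnyRoot₂`, ordinary only); claimed for every p
∤ 2N in BSTW §5.4 via the two-variable zeta element and ERL II′ (Thm 5.11). It is what lets K2R
instantiate K1's ∀-over-frames package; without it K1 is vacuous-if-empty and K2 carried the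
construction silently. -/
@[route_item "route-BirchSwinnertonDyer-SignedBaseChange"]
def GreenbergFramesAtSupersingular : Prop :=
  ∀ {p : ℕ} [Fact p.Prime] (ι : PadicAlgCl p ≃+* ℂ) (W : WeierstrassCurve ℚ) [W.IsElliptic] [W.IsGloballyMinimal] (K : Type) [Field K] [NumberField K] (v vbar : IsDedekindDomain.HeightOneSpectrum (NumberField.RingOfIntegers K)) (κ₁ κ₂ : Literature.NumberTheory.EllipticCurves.ZpExtension K p) (γ₁ γ₂ : Field.absoluteGaloisGroup K) [Fact (Literature.NumberTheory.EllipticCurves.ZpExtension.IsTopGeneratorPair κ₁ κ₂ γ₁ γ₂)] {N : ℕ} [NeZero N] {f : CuspForm (CongruenceSubgroup.Gamma0 N) 2} (_ : Literature.NumberTheory.EllipticCurves.ModularForms.IsNewformOf W f) [NeZero (NumberField.discr K).natAbs], (N : ℤ) = W.conductorNorm ℤ → 5 ≤ p → ¬ (p : ℤ) ∣ W.conductorNorm ℤ → W.frobeniusTrace p = 0 → Literature.NumberTheory.EllipticCurves.IsImaginaryQuadratic K → ((Ideal.span {(p : ℤ)}).primesOver (NumberField.RingOfIntegers K)).ncard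 = 2 → ((p : ℕ) : NumberField.RingOfIntegers K) ∈ v.asIdeal → ((p : ℕ) : NumberField.RingOfIntegers K) ∈ vbar.asIdeal → vbar ≠ v → (∀ (w : NumberField.InfinitePlace K) (k : NumberField.RingOfIntegers K), k ∈ v.asIdeal ↔ ‖ι.symm (w.embedding (k : K))‖ < 1) → IsCoprime (N : ℤ) (NumberField.discr K) → κ₁.IsCyclotomic → κ₂.IsAnticyclotomic → (∃ (Ω δ : ℂ) (Ωp : (Literature.NumberTheory.EllipticCurves.unrIntegers p)ˣ) (LK : PowerSeries (PowerSeries (PadicComplexInt p))), Ω ≠ 0 ∧ (δ ^ 2 = (NumberField.discr K : ℂ) ∨ δ ^ 2 = -(NumberField.discr K : ℂ)) ∧ Literature.NumberTheory.EllipticCurves.IsKatzMeasure₂ ι v vbar ∅ κ₁ κ₂ γ₁⁻¹ γ₂⁻¹ 1 Ω δ ((Ωp : Literature.NumberTheory.EllipticCurves.unrIntegers p) : PadicComplex p) LK) ∧ (∀ (Ω δ : ℂ) (Ωp : (Literature.NumberTheory.EllipticCurves.unrIntegers p)ˣ) (LK : PowerSeries (PowerSeries (PadicComplexInt p))), Ω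 ≠ 0 → (δ ^ 2 = (NumberField.discr K : ℂ) ∨ δ ^ 2 = -(NumberField.discr K : ℂ)) → Literature.NumberTheory.EllipticCurves.IsKatzMeasure₂ ι v vbar ∅ κ₁ κ₂ γ₁⁻¹ γ₂⁻¹ 1 Ω δ ((Ωp : Literature.NumberTheory.EllipticCurves.unrIntegers p) : PadicComplex p) LK → ∃ G : PowerSeries (PowerSeries (PadicComplexInt p)), Literature.NumberTheory.EllipticCurves.IsGreenbergLFunctionAnyRoot₂ ι v vbar κ₁ κ₂ γ₁⁻¹ γ₂⁻¹ f (NumberField.discr K).natAbs (NumberField.classNumber K) LK G)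

-- parent: SignedDescentFromGreenbergProduct · child (gen 1)
/--     item stmt-BirchSwinnertonDyer-20087 · aside · rank 302 · open
    parent: SignedDescentFromGreenbergProduct · by planner
    why it might fail: K1 gives only the PRODUCT up to a cyclotomic factor s: splitting needs μ(L_p^Gr) = 0 for f and f', the Kato bound for all four ℚ-pieces at once, and a period comparison under base change printed only for ORDINARY p (arXiv:2512.08599 Thm 1.2); ± descent printed for square-free N.
    sources: Kobayashi2003, BDKim2013, BurungaleSkinnerTianWan2024, arXiv:2512.08599, Wan2015HilbertIMC
[crux] (K2R, descent half of K2) Kobayashi2003 Thm 4.1 → Thm 1.2 → F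
(`GreenbergFramesAtSupersingular`) → for p ≥ 5, ClassX7, Surj: the K1 package (product Greenberg
divisibility up to s ∈ 𝒪_{ℂ_p}⟦T₁⟧∖0 for (E, E^(d)) over K) implies `KobayashiMainConjecture W p ε`
for both signs ε. K2 verbatim with the frame-existence input F made an explicit hypothesis (glue F →
K2R → K2 is modus ponens); the registered K2 skeleton (stub_delocalise / stub_signedDescent) is the
plan for K2R. -/
@[route_item "route-BirchSwinnertonDyer-SignedBaseChange"]
def SignedDescentFromGreenbergFrames : Prop :=
  Literature.NumberTheory.EllipticCurves.Kobayashi2003.thm41_signedCharIdeal_divisibility → Literature.NumberTheory.EllipticCurves.Kobayashi2003.thm12_signedSelmerDual_finite_torsion → GreenbergFramesAtSupersingular → ∀ (W : WeierstrassCurve ℚ) [W.IsElliptic] [W.IsGloballyMinimal] (p : ℕ) [Fact p.Prime], 5 ≤ p → Literature.NumberTheory.EllipticCurves.Rank1Residual.ClassX7 W p → Literature.NumberTheory.EllipticCurves.Rank1Residual.Surj W p → (∃ (K : Type) (_ : Field K) (_ : NumberField K) (ι : PadicAlgCl p ≃+* ℂ) (v vbar : IsDedekindDomain.HeightOneSpectrum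 (NumberField.RingOfIntegers K)) (κ₁ κ₂ : Literature.NumberTheory.EllipticCurves.ZpExtension K p) (γ₁ γ₂ : Field.absoluteGaloisGroup K) (_ : Fact (Literature.NumberTheory.EllipticCurves.ZpExtension.IsTopGeneratorPair κ₁ κ₂ γ₁ γ₂)) (_ : NeZero (NumberField.discr K).natAbs) (N : ℕ) (_ : NeZero N) (f : CuspForm (CongruenceSubgroup.Gamma0 N) 2) (d : ℤ) (W' : WeierstrassCurve ℚ) (_ : W'.IsElliptic) (_ : W'.IsGloballyMinimal) (C : WeierstrassCurve.VariableChange ℚ) (N' : ℕ) (_ : NeZero N') (f' : CuspForm (CongruenceSubgroup.Gamma0 N') 2), Literature.NumberTheory.EllipticCurves.ModularForms.IsNewformOf W f ∧ (N : ℤ) = W.conductorNorm ℤ ∧ Literature.NumberTheory.EllipticCurves.ModularForms.IsNewformOf W' f' ∧ (N' : ℤ) = W'.conductorNorm ℤ ∧ Squarefree d ∧ 1 < d ∧ (∀ q : ℕ, q.Prime → Literature.NumberTheory.EllipticCurves.BurungaleSkinnerTianWan2024.RamifiedInQuadratic d q → q ≠ p ∧ ¬ q ∣ N ∧ ¬ (q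 : ℤ) ∣ NumberField.discr K) ∧ C • W' = W.quadraticTwist (d : ℚ) ∧ Literature.NumberTheory.EllipticCurves.IsImaginaryQuadratic K ∧ ((Ideal.span {(p : ℤ)}).primesOver (NumberField.RingOfIntegers K)).ncard = 2 ∧ ((p : ℕ) : NumberField.RingOfIntegers K) ∈ v.asIdeal ∧ ((p : ℕ) : NumberField.RingOfIntegers K) ∈ vbar.asIdeal ∧ vbar ≠ v ∧ (∀ (w : NumberField.InfinitePlace K) (k : NumberField.RingOfIntegers K), k ∈ v.asIdeal ↔ ‖ι.symm (w.embedding (k : K))‖ < 1) ∧ IsCoprime (N : ℤ) (NumberField.discr K) ∧ (∀ ρ : Literature.NumberTheory.GaloisRepresentations.ModPGaloisRep K (ZMod p) 2, (W.baseChange K).IsTorsionGaloisRep p ρ → Literature.NumberTheory.GaloisRepresentations.FramedRep.IsAbsolutelyIrreducible ρ) ∧ κ₁.IsCyclotomic ∧ κ₂.IsAnticyclotomic ∧ ∀ (Ω δ : ℂ) (Ωp : (Literature.NumberTheory.EllipticCurves.unrIntegers p)ˣ) (LK G G' : PowerSeries (PowerSeries (PadicComplexInt p))), Ω ≠ 0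 → (δ ^ 2 = (NumberField.discr K : ℂ) ∨ δ ^ 2 = -(NumberField.discr K : ℂ)) → Literature.NumberTheory.EllipticCurves.IsKatzMeasure₂ ι v vbar ∅ κ₁ κ₂ γ₁⁻¹ γ₂⁻¹ 1 Ω δ ((Ωp : Literature.NumberTheory.EllipticCurves.unrIntegers p) : PadicComplex p) LK → Literature.NumberTheory.EllipticCurves.IsGreenbergLFunctionAnyRoot₂ ι v vbar κ₁ κ₂ γ₁⁻¹ γ₂⁻¹ f (NumberField.discr K).natAbs (NumberField.classNumber K) LK G → Literature.NumberTheory.EllipticCurves.IsGreenbergLFunctionAnyRoot₂ ι v vbar κ₁ κ₂ γ₁⁻¹ γ₂⁻¹ f' (NumberField.discr K).natAbs (NumberField.classNumber K) LK G' → ∀ J : ℤ_[p] →+* PadicComplexInt p, (∀ x : ℤ_[p], ((J x : PadicComplexInt p) : PadicComplex p) = ((x : ℚ_[p]) : PadicComplex p)) → ∃ s : PowerSeries (PadicComplexInt p), s ≠ 0 ∧ Ideal.span {PowerSeries.map (PowerSeries.C (R := PadicComplexInt p)) s} * ((WeierstrassCurve.XGr₂.charIdeal (W.baseChange K) p κ₁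 κ₂ vbar γ₁ γ₂).map (Literature.NumberTheory.EllipticCurves.IwasawaAlgebra₂.toUnr₂ p J) * (WeierstrassCurve.XGr₂.charIdeal (W'.baseChange K) p κ₁ κ₂ vbar γ₁ γ₂).map (Literature.NumberTheory.EllipticCurves.IwasawaAlgebra₂.toUnr₂ p J)) ≤ Ideal.span {G * G'}) → ∀ ε : ℤˣ, Summit.BirchSwinnertonDyer.Rank1Residual.Supersingular.KobayashiMainConjecture W p ε

-- parent: SignedDescentFromGreenbergProduct · glue (gen 1)
/--     item stmt-BirchSwinnertonDyer-20088 · support · rank 303 · closed · proved by Summit.BirchSwinnertonDyer.BirchSwinnertonDyer.Theorems.SignedBaseChangeK2SplitGlue.signedDescentFromGreenbergProductOfFrames_holds (planner)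
    parent: SignedDescentFromGreenbergProduct · GLUE: children ⟹ parent · by planner
F → K2R → K2: modus ponens (K2R is K2 with the frame-existence input F as an explicit hypothesis);
provable now: fun hF h h41 h12 => h h41 h12 hF -/
@[route_item "route-BirchSwinnertonDyer-SignedBaseChange"]
def SignedDescentFromGreenbergProductOfFrames : Prop :=
  GreenbergFramesAtSupersingular → SignedDescentFromGreenbergFrames → SignedDescentFromGreenbergProduct

-- `SignedDescentFromGreenbergProductOfFrames` holds: proved by `Summit.BirchSwinnertonDyer.BirchSwinnertonDyer.Theorems.SignedBaseChangeK2SplitGlue.signedDescentFromGreenbergProductOfFrames_holds` (its module imports this route file, so no `_holds` link can be stated here).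

/-- item stmt-BirchSwinnertonDyer-20251 · aside · rank 5 · open · by planner
why it might fail: at p = 3 supersingular a₃ ∈ {0, ±3}: a₃ = ±3 needs Sprung's ♯/♭ theory whose Eisenstein lower bound is printed only for square-free N (Sprung2024), and the rank-1 consumer BurungaleKobayashiOta2023 Cor A.5 is used in the tree for p ≥ 5 only.
sources: Sprung2024, Sprung2012, BurungaleKobayashiOta2023, Kobayashi2003
[crux · RESIDUAL conjunct, not attacked by this route] (R) the p = 3 slice of the leaf: for p = 3,
non-CM, ClassX7 W 3, analytic rank ≤ 1: BSD₃(W). OWNER: rung leaf K3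
`Summit.BirchSwinnertonDyer.Rank1Residual.Supersingular.SignedSupersingular` (route
SignedLowerHalves' target) — R is provably its slice by the Theses-free closer
`Summit.BirchSwinnertonDyer.Rank1Residual.WAll.cornerX7AtThree_of_signedSupersingular` (R ⇐
SignedSupersingular + Wuthrich2014 + GZK + modularity; file
Rank1Residual/WAll/AltClosersAdditiveCells.lean, p496412 accepted; NOT imported here by design). Why
it might fail as a statement: at p = 3 supersingular a₃ ∈ {0, ±3}; a₃ = ±3 needs Sprung's ♯/♭ theory
whose Eisenstein lower bound is printed only for square-free N (Sprung2024), and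
BurungaleKobayashiOta2023 Cor. A.5 is used in the tree for p ≥ 5 only. Sources: Sprung2024,
Sprung2012, BurungaleKobayashiOta2023, Kobayashi2003. -/
@[route_item "route-BirchSwinnertonDyer-SignedBaseChange"]
def CornerX7AtThree : Prop :=
  ∀ (W : WeierstrassCurve ℚ) [W.IsElliptic] [W.IsGloballyMinimal] (p : ℕ) [Fact p.Prime], p = 3 → ¬ W.HasCM → Literature.NumberTheory.EllipticCurves.Rank1Residual.ClassX7 W p → W.analyticRank ≤ 1 → Literature.NumberTheory.EllipticCurves.BSDp W p

/-- item stmt-BirchSwinnertonDyer-19005 · support · rank 9 · SPLIT (gen 1) into WuthrichShaDividesAnalyticSha, KobayashiSignedSelmerTorsion, KobayashiSignedKatoDivisibility, BDKimSignedCharValueRankZero, BKOSignedPPartRankOne, RealPeriodUnitPlusPeriod, RealPeriodUnitPlusPeriodThree, ModularParametrizationSupply, EntireLFunctionRat, RankEqAnalyticRankLeOne + glue PublishedSignedInputsGlue · direct attempts still welcome (low priority) · by planner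
sources: Wuthrich2014, Kobayashi2003, BDKim2013, BurungaleKobayashiOta2023, BCDTJAMS2001
[support] the conjunction of the PUBLISHED named facts the deciding theorem consumes, by name:
Wuthrich 2014 Prop. 21 (`sha_dvd_analyticSha`), Kobayashi 2003 Thm. 1.2 (`thm12_…`) and Thm. 4.1
(`thm41_…`), B. D. Kim 2013 Cor. 3.15 (`cor315_…`), Burungale–Kobayashi–Ota 2024 Cor. A.5
(`corA5_…`, flags IMC-unpinned / proof-by-reference recorded in its docstring), the period relations
`realPeriodRat_eq_unit_mul_plusPeriod(_three)`, modularity (`nonempty_modularParametrizationData`,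
`hasEntireLFunction_rat`), GZK (`rank_eq_analyticRank_of_analyticRank_le_one`). Closable by
`⟨…_holds, …⟩` as the facts get `_holds` theorems; until then it is the honest list of print inputs.
[difficulty: provable-now] -/
@[route_item "route-BirchSwinnertonDyer-SignedBaseChange", crux]
def PublishedSignedInputs : Prop :=
  Literature.NumberTheory.EllipticCurves.Wuthrich2014.sha_dvd_analyticSha ∧ Literature.NumberTheory.EllipticCurves.Kobayashi2003.thm12_signedSelmerDual_finite_torsion ∧ Literature.NumberTheory.EllipticCurves.Kobayashi2003.thm41_signedCharIdeal_divisibility ∧ Literature.NumberTheory.EllipticCurves.BDKim2013.cor315_signedCharValue_rankZero ∧ Literature.NumberTheory.EllipticCurves.BurungaleKobayashiOta2024.corA5_pPart_of_signedCharIdeal_eq ∧ Literature.NumberTheory.EllipticCurves.realPeriodRat_eq_unit_mul_plusPeriod ∧ Literature.NumberTheory.EllipticCurves.realPeriodRat_eq_unit_mul_plusPeriod_three ∧ Literature.NumberTheory.EllipticCurves.ModularForms.nonempty_modularParametrizationData ∧ WeierstrassCurve.hasEntireLFunction_rat ∧ Literature.NumberTheory.EllipticCurves.rank_eq_analyticR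ank_of_analyticRank_le_one

-- parent: PublishedSignedInputs · child (gen 1)
/--     item stmt-BirchSwinnertonDyer-19285 · support · rank 901 · open
    parent: PublishedSignedInputs · by operator
    sources: Wuthrich2014
[support] Wuthrich 2014 Prop. 21 (p. 400): #Ш[p^∞] divides the analytic Ш under the Kato-side
divisibility (reducible/any image) — conjunct of PublishedSignedInputs
(stmt-BirchSwinnertonDyer-19005), BY NAME; same content, filed as a split child so the head constant
is item-stated (gate5 #15c one rule; readiness rule 2026-08-15: cite_only dep declared by the
route); no statement / closes / tribunal change -/
@[route_item "route-BirchSwinnertonDyer-SignedBaseChange"]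
def WuthrichShaDividesAnalyticSha : Prop :=
  Literature.NumberTheory.EllipticCurves.Wuthrich2014.sha_dvd_analyticSha

-- parent: PublishedSignedInputs · child (gen 1)
/--     item stmt-BirchSwinnertonDyer-19286 · support · rank 902 · open
    parent: PublishedSignedInputs · by operator
    sources: Kobayashi2003
[support] Kobayashi 2003 Thm. 1.2 (p. 2): the signed Selmer duals X^±(E/ℚ_∞) are finitely generated
Λ-torsion — conjunct of PublishedSignedInputs (stmt-BirchSwinnertonDyer-19005), BY NAME; same
content, filed as a split child so the head constant is item-stated (gate5 #15c one rule; readiness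
rule 2026-08-15: cite_only dep declared by the route); no statement / closes / tribunal change -/
@[route_item "route-BirchSwinnertonDyer-SignedBaseChange"]
def KobayashiSignedSelmerTorsion : Prop :=
  Literature.NumberTheory.EllipticCurves.Kobayashi2003.thm12_signedSelmerDual_finite_torsion

-- parent: PublishedSignedInputs · child (gen 1)
/--     item stmt-BirchSwinnertonDyer-19287 · support · rank 903 · open
    parent: PublishedSignedInputs · by operator
    sources: Kobayashi2003, Kato2004Asterisque
[support] Kobayashi 2003 Thm. 1.3 / Thm. 4.1 (pp. 2, 8): Kato-side divisibility char X^± ⊇ (L^±_p)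
up to p^n — conjunct of PublishedSignedInputs (stmt-BirchSwinnertonDyer-19005), BY NAME; same
content, filed as a split child so the head constant is item-stated (gate5 #15c one rule; readiness
rule 2026-08-15: cite_only dep declared by the route); no statement / closes / tribunal change -/
@[route_item "route-BirchSwinnertonDyer-SignedBaseChange"]
def KobayashiSignedKatoDivisibility : Prop :=
  Literature.NumberTheory.EllipticCurves.Kobayashi2003.thm41_signedCharIdeal_divisibility

-- parent: PublishedSignedInputs · child (gen 1)
/--     item stmt-BirchSwinnertonDyer-19288 · support · rank 904 · closed · proved by Summit.BirchSwinnertonDyer.BirchSwinnertonDyer.Theorems.KimCor315.signedLowerHalves_bdKimSignedCharValueRankZero_proof (prover)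
    parent: PublishedSignedInputs · by operator
    sources: BDKim2013
[support] B.D. Kim 2013 Cor. 3.15 (= Thm. 1.2): the signed characteristic value at T = 0 in analytic
rank 0 (signed Euler-characteristic formula) — conjunct of PublishedSignedInputs
(stmt-BirchSwinnertonDyer-19005), BY NAME; same content, filed as a split child so the head constant
is item-stated (gate5 #15c one rule; readiness rule 2026-08-15: cite_only dep declared by the
route); no statement / closes / tribunal change -/
@[route_item "route-BirchSwinnertonDyer-SignedBaseChange"]
def BDKimSignedCharValueRankZero : Prop :=
  Literature.NumberTheory.EllipticCurves.BDKim2013.cor315_signedCharValue_rankZero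

-- `BDKimSignedCharValueRankZero` holds: proved by `Summit.BirchSwinnertonDyer.BirchSwinnertonDyer.Theorems.KimCor315.signedLowerHalves_bdKimSignedCharValueRankZero_proof` (its module imports this route file, so no `_holds` link can be stated here).

-- parent: PublishedSignedInputs · child (gen 1)
/--     item stmt-BirchSwinnertonDyer-19289 · support · rank 905 · open
    parent: PublishedSignedInputs · by operator
    sources: BurungaleKobayashiOta2023
[support] Burungale–Kobayashi–Ota 2024 Cor. A.5: the p-part of BSD in analytic rank 1 from the
signed main conjecture equality — conjunct of PublishedSignedInputs
(stmt-BirchSwinnertonDyer-19005), BY NAME; same content, filed as a split child so the head constant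
is item-stated (gate5 #15c one rule; readiness rule 2026-08-15: cite_only dep declared by the
route); no statement / closes / tribunal change -/
@[route_item "route-BirchSwinnertonDyer-SignedBaseChange"]
def BKOSignedPPartRankOne : Prop :=
  Literature.NumberTheory.EllipticCurves.BurungaleKobayashiOta2024.corA5_pPart_of_signedCharIdeal_eq

-- parent: PublishedSignedInputs · child (gen 1)
/--     item stmt-BirchSwinnertonDyer-19290 · support · rank 906 · closed · proved by Summit.BirchSwinnertonDyer.BirchSwinnertonDyer.Theorems.SignedLowerHalves.RealPeriodUnitPlusPeriod_proof (prover)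
    parent: PublishedSignedInputs · by operator
    sources: GreenbergVatsal2000
[support] Néron period vs. plus period of the newform: Ω_E = u · Ω⁺_f with u a p-adic unit, p ≥ 5
(Manin constant: Mazur 1978 Cor. 4.1, Edixhoven 1991 Prop. 2, Abbes–Ullmo 1996 Thm. A;
Greenberg–Vatsal 2000 Rem. 3.4) — conjunct of PublishedSignedInputs
(stmt-BirchSwinnertonDyer-19005), BY NAME; same content, filed as a split child so the head constant
is item-stated (gate5 #15c one rule; readiness rule 2026-08-15: cite_only dep declared by the
route); no statement / closes / tribunal change -/
@[route_item "route-BirchSwinnertonDyer-SignedBaseChange"]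
def RealPeriodUnitPlusPeriod : Prop :=
  Literature.NumberTheory.EllipticCurves.realPeriodRat_eq_unit_mul_plusPeriod

/-- `RealPeriodUnitPlusPeriod` holds: proved by `Summit.BirchSwinnertonDyer.BirchSwinnertonDyer.Theorems.SignedLowerHalves.RealPeriodUnitPlusPeriod_proof`. -/
theorem RealPeriodUnitPlusPeriod_holds : RealPeriodUnitPlusPeriod := _root_.Summit.BirchSwinnertonDyer.BirchSwinnertonDyer.Theorems.SignedLowerHalves.RealPeriodUnitPlusPeriod_proof

-- parent: PublishedSignedInputs · child (gen 1)
/--     item stmt-BirchSwinnertonDyer-19291 · support · rank 907 · closed · proved by Summit.BirchSwinnertonDyer.BirchSwinnertonDyer.Theorems.SignedLowerHalves.RealPeriodUnitPlusPeriodThree_proof (prover)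
    parent: PublishedSignedInputs · by operator
    sources: GreenbergVatsal2000
[support] the same period ratio statement at p = 3 (Manin constant a 3-adic unit in the cases used)
— conjunct of PublishedSignedInputs (stmt-BirchSwinnertonDyer-19005), BY NAME; same content, filed
as a split child so the head constant is item-stated (gate5 #15c one rule; readiness rule
2026-08-15: cite_only dep declared by the route); no statement / closes / tribunal change -/
@[route_item "route-BirchSwinnertonDyer-SignedBaseChange"]
def RealPeriodUnitPlusPeriodThree : Prop :=
  Literature.NumberTheory.EllipticCurves.realPeriodRat_eq_unit_mul_plusPeriod_three

/-- `RealPeriodUnitPlusPeriodThree` holds: proved by `Summit.BirchSwinnertonDyer.BirchSwinnertonDyer.Theorems.SignedLowerHalves.RealPeriodUnitPlusPeriodThree_proof`. -/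
theorem RealPeriodUnitPlusPeriodThree_holds : RealPeriodUnitPlusPeriodThree := _root_.Summit.BirchSwinnertonDyer.BirchSwinnertonDyer.Theorems.SignedLowerHalves.RealPeriodUnitPlusPeriodThree_proof

-- parent: PublishedSignedInputs · child (gen 1)
/--     item stmt-BirchSwinnertonDyer-19266 · support · rank 908 · open
    parent: PublishedSignedInputs · by planner
    sources: BCDTJAMS2001
[support] modularity of E/ℚ as parametrisation data (Breuil–Conrad–Diamond–Taylor 2001 Thm A), BY
NAME — conjunct of OrdPublishedInputsAtTwo (19149; Literature.Uncategorized.OrdPublishedInputsAtTwo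
l.26); same content, filed so the head constant is item-stated (#15c one rule; cite_only dep) -/
@[route_item "route-BirchSwinnertonDyer-SignedBaseChange"]
def ModularParametrizationSupply : Prop :=
  Literature.NumberTheory.EllipticCurves.ModularForms.nonempty_modularParametrizationData

-- parent: PublishedSignedInputs · child (gen 1)
/--     item stmt-BirchSwinnertonDyer-19273 · support · rank 909 · open
    parent: PublishedSignedInputs · by planner
    sources: BCDTJAMS2001
[support] entire continuation of L(E/ℚ, s) (modularity: Breuil–Conrad–Diamond–Taylor 2001 Thm A +
Hecke/Shimura), BY NAME — conjunct of MultConversePublishedInputsAtTwo (19185); same content, filed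
so the head constant is item-stated (#15c one rule; cite_only dep) -/
@[route_item "route-BirchSwinnertonDyer-SignedBaseChange"]
def EntireLFunctionRat : Prop :=
  WeierstrassCurve.hasEntireLFunction_rat

-- parent: PublishedSignedInputs · child (gen 1)
/--     item stmt-BirchSwinnertonDyer-19921 · support · rank 910 · open
    parent: PublishedSignedInputs · by operator
    sources: GrossZagier1986, Kolyvagin1990
[support] The one PUBLISHED input the halves-glue consumes: Gross–Zagier–Kolyvagin, rank = analytic
rank for analytic rank ≤ 1 with Ш finite (tree named fact
rank_eq_analyticRank_of_analyticRank_le_one; used by bsdp_of_missingPPartAt to turn Miller's last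
clause into BSD(E,2)). Carried as a displayed PUB hypothesis; never counted as progress. The further
PRINT of the roads to the two halves (Greenberg Thm-4.1 analogues at a multiplicative prime
thm41Analogue_charValue_rankZero_numberField_anyPrime / …_split_baseChange_anyPrime, modularity) and
the referee-passed MEMO inputs (Kato ⊗ℚ at a multiplicative 2:
X5.O1.KatoMultiplicativeDivisibilityRat W 2, HOME mult/PROOF-MULT.md RC-2; Greenberg–Stevens at 2:
greenberg_stevens W 2, mult/PROOF-GS2.md RC-4) enter the LINES under the halves (bridge
multiplicativeRankZeroAtTwo_of_muRoad, p409679), not this glue. -/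
@[route_item "route-BirchSwinnertonDyer-SignedBaseChange"]
def RankEqAnalyticRankLeOne : Prop :=
  Literature.NumberTheory.EllipticCurves.rank_eq_analyticRank_of_analyticRank_le_one

-- parent: PublishedSignedInputs · glue (gen 1)
/--     item stmt-BirchSwinnertonDyer-20273 · support · rank 911 · closed · proved by Summit.BirchSwinnertonDyer.BirchSwinnertonDyer.Theorems.SignedBaseChangePublishedSignedInputsGlue.publishedSignedInputsGlue_holds (planner)
    parent: PublishedSignedInputs · GLUE: children ⟹ parent · by planner
children = the ten cite_only conjuncts of PublishedSignedInputs BY NAME, in conjunct order; glue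
PublishedSignedInputsOfParts : C1 → … → C10 → PublishedSignedInputs is the anonymous constructor
(exactly as route SignedLowerHalves' item 19292, proved there by
Theorems.publishedSignedInputsOfParts_holds) -/
@[route_item "route-BirchSwinnertonDyer-SignedBaseChange"]
def PublishedSignedInputsGlue : Prop :=
  WuthrichShaDividesAnalyticSha → KobayashiSignedSelmerTorsion → KobayashiSignedKatoDivisibility → BDKimSignedCharValueRankZero → BKOSignedPPartRankOne → RealPeriodUnitPlusPeriod → RealPeriodUnitPlusPeriodThree → ModularParametrizationSupply → EntireLFunctionRat → RankEqAnalyticRankLeOne → PublishedSignedInputs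

-- `PublishedSignedInputsGlue` holds: proved by `Summit.BirchSwinnertonDyer.BirchSwinnertonDyer.Theorems.SignedBaseChangePublishedSignedInputsGlue.publishedSignedInputsGlue_holds` (its module imports this route file, so no `_holds` link can be stated here).

/-- item stmt-BirchSwinnertonDyer-20330 · support · rank 9 · open · by planner
[support] (GSF, cite-only PREPRINT binder; difficulty cite-only) Burungale–Skinner–Tian–Wan
arXiv:2409.01350v2 §6.4 ‘Integral normalisations’ + Thm 6.17 (Explicit Reciprocity Law II′) +
§6.6.1, in the print-faithful quantifier order «∀ K-data ∃ ONE Katz frame (the periods of Theorem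
(pKatzL) = Thm 4.19 are L-data) ∀ newform f_E supersingular at p ≥ 5 (p ∤ N_E, a_p = 0, (N_E, D_K) =
1) ∃ G = 𝓛_p^Gr(f/K) integral in the reduction-type-free value frame
`IsGreenbergLFunctionAnyRoot₂`»: VERBATIM the typed binder
`BurungaleSkinnerTianWan2024.thm617_exists_commonKatzFrame_isGreenbergLFunctionAnyRoot₂_supersingular_PRE`
([claim: under-review], never a theorem). Replaces the construction half F
(`GreenbergFramesAtSupersingular`) of K2, whose conjunct (b) «over EVERY Katz frame» is an unprinted
period-rescaling statement and whose conjunct (a) asserted de Shalit II.4.17 outright. Sources: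
BurungaleSkinnerTianWan2024, YanZhu2024MainConjNonCM, CastellaGrossiSkinner2025, deShalit1987. -/
@[route_item "route-BirchSwinnertonDyer-SignedBaseChange", crux]
def GreenbergSupersingularFrameInput : Prop :=
  Literature.NumberTheory.EllipticCurves.BurungaleSkinnerTianWan2024.thm617_exists_commonKatzFrame_isGreenbergLFunctionAnyRoot₂_supersingular_PRE

-- earlier SignedLowerDescentFromCommonFrame (stmt-BirchSwinnertonDyer-20503, replaced 2026-08-27T09:37:50Z -> stmt-BirchSwinnertonDyer-20213): retired by None — Literature.NumberTheory.EllipticCurves.Kobayashi2003.thm41_signedCharIdeal_divisibility → Literature.NumberTheory.EllipticCurves.Kobayashi2003.thm12_signedSelmerDual_finite_torsion → GreenbergSupersingularFrameInput → ∀ (W : WeierstrassCurve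
/-- item stmt-BirchSwinnertonDyer-20213 · aside · rank 3 · open · by planner
why it might fail: two-variable signed Selmer / signed L carriers over K_∞ (B.D. Kim 2014, Loeffler 2014) untyped; BSTW Prop 9.18/10.7 preprint, square-free N; anticyclotomic μ = 0 printed only under classical Heegner (Burungale 2017, Hsieh 2014); Ω_{g/K} ~ Ω_g·Ω_{g⊗χ_K} printed for square-free N only
sources: arXiv:2409.01350, Kobayashi2003
[crux] (K2R‴ = K2R″ + two published antecedents; K2R″, gen 4 = K2R′ 20417 re-targeted to the
Eisenstein half per the prover census F1 of bsd-wall-sbc-p2, K2R-CENSUS-v1.md) signed two-variable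
descent: from Kobayashi Thm 4.1 / Thm 1.2 (named facts), modularity (route alias
ModularParametrizationSupply := Literature…ModularForms.nonempty_modularParametrizationData —
newforms for the minimal models of E^K, E^(dK) in the product squeeze) and the period-unit fact
(route alias RealPeriodUnitPlusPeriod := Literature…realPeriodRat_eq_unit_mul_plusPeriod;
ϖ⁻¹-integrality when converting the f-normalised descent output to the Néron-normalised
KobayashiLowerDivisibility) — both PUB conjuncts 8/6 BY NAME (aliases used only to stay under the
4000-char signature cap), added as antecedents at rev 12 (K2R‴, freeze exception #1, binder omission
found by bsd-wall-sbc-p2 F3) — the BSTW common-frame binder GSF (GreenbergSupersingularFrameInput)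
and K1′'s Greenberg PRODUCT package for the twist pair (E, E^(d)) over K, conclude the EISENSTEIN
HALF `∀ ε, KobayashiLowerDivisibility W p ε` (char X^ε = (g), ι g = ϖ·ι(L^ε·h)); the squeeze to
Kobayashi's main conjecture is the glue item KobayashiSqueeze fed b -/
@[route_item "route-BirchSwinnertonDyer-SignedBaseChange"]
def SignedLowerDescentFromCommonFrame : Prop :=
  Literature.NumberTheory.EllipticCurves.Kobayashi2003.thm41_signedCharIdeal_divisibility → Literature.NumberTheory.EllipticCurves.Kobayashi2003.thm12_signedSelmerDual_finite_torsion → ModularParametrizationSupply → RealPeriodUnitPlusPeriod → GreenbergSupersingularFrameInput → ∀ (W : WeierstrassCurve ℚ) [W.IsElliptic] [W.IsGloballyMinimal] (p : ℕ) [Fact p.Prime], 5 ≤ p → Literature.NumberTheory.EllipticCurves.Rank1Residual.ClassX7 W p → Literature.NumberTheory.EllipticCurves.Rank1Residual.Surj W p → (∃ (K : Type) (_ : Field K) (_ : NumberField K) (ι : PadicAlgCl p ≃+* ℂ) (v vbar : IsDedekindDomain.HeightOneSpectrum (NumberField.RingOfIntegers K)) (κ₁ κ₂ : Literature.NumberTheory.EllipticCurves.ZpExtension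 K p) (γ₁ γ₂ : Field.absoluteGaloisGroup K) (_ : Fact (Literature.NumberTheory.EllipticCurves.ZpExtension.IsTopGeneratorPair κ₁ κ₂ γ₁ γ₂)) (_ : NeZero (NumberField.discr K).natAbs) (N : ℕ) (_ : NeZero N) (f : CuspForm (CongruenceSubgroup.Gamma0 N) 2) (d : ℤ) (W' : WeierstrassCurve ℚ) (_ : W'.IsElliptic) (_ : W'.IsGloballyMinimal) (C : WeierstrassCurve.VariableChange ℚ) (N' : ℕ) (_ : NeZero N') (f' : CuspForm (CongruenceSubgroup.Gamma0 N') 2), Literature.NumberTheory.EllipticCurves.ModularForms.IsNewformOf W f ∧ (N : ℤ) = W.conductorNorm ℤ ∧ Literature.NumberTheory.EllipticCurves.ModularForms.IsNewformOf W' f' ∧ (N' : ℤ) = W'.conductorNorm ℤ ∧ Squarefree d ∧ 1 < d ∧ (∀ q : ℕ, q.Prime → Literature.NumberTheory.EllipticCurves.BurungaleSkinnerTianWan2024.RamifiedInQuadratic d q → q ≠ p ∧ ¬ q ∣ N ∧ ¬ (q : ℤ) ∣ NumberField.discr K) ∧ C • W' = W.quadraticTwist (d : ℚ) ∧ Literature.NumberTheory.EllipticCurves.IsImaginaryQuadratic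 K ∧ ((Ideal.span {(p : ℤ)}).primesOver (NumberField.RingOfIntegers K)).ncard = 2 ∧ ((p : ℕ) : NumberField.RingOfIntegers K) ∈ v.asIdeal ∧ ((p : ℕ) : NumberField.RingOfIntegers K) ∈ vbar.asIdeal ∧ vbar ≠ v ∧ (∀ (w : NumberField.InfinitePlace K) (k : NumberField.RingOfIntegers K), k ∈ v.asIdeal ↔ ‖ι.symm (w.embedding (k : K))‖ < 1) ∧ IsCoprime (N : ℤ) (NumberField.discr K) ∧ (∀ ℓ : ℕ, ℓ.Prime → ℓ ∣ N → ((Ideal.span {(ℓ : ℤ)}).primesOver (NumberField.RingOfIntegers K)).ncard = 2) ∧ (∀ ℓ : ℕ, ℓ.Prime → (ℓ : ℤ) ∣ d → ((Ideal.span {(ℓ : ℤ)}).primesOver (NumberField.RingOfIntegers K)).ncard = 2) ∧ ((Ideal.span {(2 : ℤ)}).primesOver (NumberField.RingOfIntegers K)).ncard = 2 ∧ (∀ ρ : Literature.NumberTheory.GaloisRepresentations.ModPGaloisRep K (ZMod p) 2, (W.baseChange K).IsTorsionGaloisRep p ρ → Literature.NumberTheory.GaloisRepresentations.FramedRep.IsAbsolutelyIrreducible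 ρ) ∧ κ₁.IsCyclotomic ∧ κ₂.IsAnticyclotomic ∧ ∀ (Ω δ : ℂ) (Ωp : (Literature.NumberTheory.EllipticCurves.unrIntegers p)ˣ) (LK G G' : PowerSeries (PowerSeries (PadicComplexInt p))), Ω ≠ 0 → (δ ^ 2 = (NumberField.discr K : ℂ) ∨ δ ^ 2 = -(NumberField.discr K : ℂ)) → Literature.NumberTheory.EllipticCurves.IsKatzMeasure₂ ι v vbar ∅ κ₁ κ₂ γ₁⁻¹ γ₂⁻¹ 1 Ω δ ((Ωp : Literature.NumberTheory.EllipticCurves.unrIntegers p) : PadicComplex p) LK → Literature.NumberTheory.EllipticCurves.IsGreenbergLFunctionAnyRoot₂ ι v vbar κ₁ κ₂ γ₁⁻¹ γ₂⁻¹ f (NumberField.discr K).natAbs (NumberField.classNumber K) LK G → Literature.NumberTheory.EllipticCurves.IsGreenbergLFunctionAnyRoot₂ ι v vbar κ₁ κ₂ γ₁⁻¹ γ₂⁻¹ f' (NumberField.discr K).natAbs (NumberField.classNumber K) LK G' → ∀ J : ℤ_[p] →+* PadicComplexInt p, (∀ x : ℤ_[p], ((J x : PadicComplexInt p) : PadicComplex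 p) = ((x : ℚ_[p]) : PadicComplex p)) → ∃ s : PowerSeries (PadicComplexInt p), s ≠ 0 ∧ Ideal.span {PowerSeries.map (PowerSeries.C (R := PadicComplexInt p)) s} * ((WeierstrassCurve.XGr₂.charIdeal (W.baseChange K) p κ₁ κ₂ vbar γ₁ γ₂).map (Literature.NumberTheory.EllipticCurves.IwasawaAlgebra₂.toUnr₂ p J) * (WeierstrassCurve.XGr₂.charIdeal (W'.baseChange K) p κ₁ κ₂ vbar γ₁ γ₂).map (Literature.NumberTheory.EllipticCurves.IwasawaAlgebra₂.toUnr₂ p J)) ≤ Ideal.span {G * G'}) → ∀ ε : ℤˣ, Summit.BirchSwinnertonDyer.Rank1Residual.Supersingular.KobayashiLowerDivisibility W p ε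

/-- item stmt-BirchSwinnertonDyer-20417 · aside (kind.auto-crux: conjecture-grade) · rank 3 · open · by planner
why it might fail: auto-crux — conjecture-grade (statement references the registered conjecture Summit.BirchSwinnertonDyer.Rank1Residual.Supersingular.KobayashiMainConje): the deciding theorem assumes it and nothing in the route derives it, so it is a bet, not glue
sources: closes-admissibility
[crux] (K2R′, supersedes K2R `SignedDescentFromGreenbergFrames` as the load-bearing DESCENT;
difficulty L) Kobayashi2003 Thm 4.1 (Kato-side ± divisibility, integral under Surj) → Kobayashi2003
Thm 1.2 (± control) → GSF (`GreenbergSupersingularFrameInput`: one common Katz frame with an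
integral Greenberg G for every admissible supersingular newform over it) → for p ≥ 5, ClassX7 W p,
ρ̄ surjective: the K1 package (product Greenberg divisibility for (W, W^(d)) over K up to s ∈ Λ^cyc
∖ 0, ∀ over frames (L_K, G, G′)) implies `KobayashiMainConjecture W p ε` for BOTH signs — K2R
verbatim with the frame-supply antecedent F replaced by GSF (instantiating K1's ∀-over-frames clause
needs G for f AND G′ for f′ over ONE L_K;
`BurungaleSkinnerTianWan2024.exists_commonKatzFrame_greenberg_pair` hands exactly that tuple). Why
it might fail: K1 gives only the PRODUCT up to a Λ^cyc factor s — de-localisation needs μ(𝓛_p^Gr) =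
0 for f and f′ at a SUPERSINGULAR p (printed for neither), and splitting the integral product into
Kobayashi's ± main conjecture for ONE curve needs the Kato bound for all four ℚ-pieces at once plus
a canonical-period comparison under base change printed only at ORDINARY p (Lv–X -/
@[route_item "route-BirchSwinnertonDyer-SignedBaseChange"]
def SignedDescentFromCommonFrame : Prop :=
  Literature.NumberTheory.EllipticCurves.Kobayashi2003.thm41_signedCharIdeal_divisibility → Literature.NumberTheory.EllipticCurves.Kobayashi2003.thm12_signedSelmerDual_finite_torsion → GreenbergSupersingularFrameInput → ∀ (W : WeierstrassCurve ℚ) [W.IsElliptic] [W.IsGloballyMinimal] (p : ℕ) [Fact p.Prime], 5 ≤ p → Literature.NumberTheory.EllipticCurves.Rank1Residual.ClassX7 W p → Literature.NumberTheory.EllipticCurves.Rank1Residual.Surj W p → (∃ (K : Type) (_ : Field K) (_ : NumberField K) (ι : PadicAlgCl p ≃+* ℂ) (v vbar : IsDedekindDomain.HeightOneSpectrum (NumberField.RingOfIntegers K)) (κ₁ κ₂ : Literature.NumberTheory.EllipticCurves.ZpExtension K p) (γ₁ γ₂ : Field.absoluteGaloisGroup K) (_ : Fact (Literature.NumberTheory.EllipticCurves.ZpExtension.IsTopGeneratorPair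 κ₁ κ₂ γ₁ γ₂)) (_ : NeZero (NumberField.discr K).natAbs) (N : ℕ) (_ : NeZero N) (f : CuspForm (CongruenceSubgroup.Gamma0 N) 2) (d : ℤ) (W' : WeierstrassCurve ℚ) (_ : W'.IsElliptic) (_ : W'.IsGloballyMinimal) (C : WeierstrassCurve.VariableChange ℚ) (N' : ℕ) (_ : NeZero N') (f' : CuspForm (CongruenceSubgroup.Gamma0 N') 2), Literature.NumberTheory.EllipticCurves.ModularForms.IsNewformOf W f ∧ (N : ℤ) = W.conductorNorm ℤ ∧ Literature.NumberTheory.EllipticCurves.ModularForms.IsNewformOf W' f' ∧ (N' : ℤ) = W'.conductorNorm ℤ ∧ Squarefree d ∧ 1 < d ∧ (∀ q : ℕ, q.Prime → Literature.NumberTheory.EllipticCurves.BurungaleSkinnerTianWan2024.RamifiedInQuadratic d q → q ≠ p ∧ ¬ q ∣ N ∧ ¬ (q : ℤ) ∣ NumberField.discr K) ∧ C • W' = W.quadraticTwist (d : ℚ) ∧ Literature.NumberTheory.EllipticCurves.IsImaginaryQuadratic K ∧ ((Ideal.span {(p : ℤ)}).primesOver (NumberField.RingOfIntegers K)).ncard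 = 2 ∧ ((p : ℕ) : NumberField.RingOfIntegers K) ∈ v.asIdeal ∧ ((p : ℕ) : NumberField.RingOfIntegers K) ∈ vbar.asIdeal ∧ vbar ≠ v ∧ (∀ (w : NumberField.InfinitePlace K) (k : NumberField.RingOfIntegers K), k ∈ v.asIdeal ↔ ‖ι.symm (w.embedding (k : K))‖ < 1) ∧ IsCoprime (N : ℤ) (NumberField.discr K) ∧ (∀ ρ : Literature.NumberTheory.GaloisRepresentations.ModPGaloisRep K (ZMod p) 2, (W.baseChange K).IsTorsionGaloisRep p ρ → Literature.NumberTheory.GaloisRepresentations.FramedRep.IsAbsolutelyIrreducible ρ) ∧ κ₁.IsCyclotomic ∧ κ₂.IsAnticyclotomic ∧ ∀ (Ω δ : ℂ) (Ωp : (Literature.NumberTheory.EllipticCurves.unrIntegers p)ˣ) (LK G G' : PowerSeries (PowerSeries (PadicComplexInt p))), Ω ≠ 0 → (δ ^ 2 = (NumberField.discr K : ℂ) ∨ δ ^ 2 = -(NumberField.discr K : ℂ)) → Literature.NumberTheory.EllipticCurves.IsKatzMeasure₂ ι v vbar ∅ κ₁ κ₂ γ₁⁻¹ γ₂⁻¹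 1 Ω δ ((Ωp : Literature.NumberTheory.EllipticCurves.unrIntegers p) : PadicComplex p) LK → Literature.NumberTheory.EllipticCurves.IsGreenbergLFunctionAnyRoot₂ ι v vbar κ₁ κ₂ γ₁⁻¹ γ₂⁻¹ f (NumberField.discr K).natAbs (NumberField.classNumber K) LK G → Literature.NumberTheory.EllipticCurves.IsGreenbergLFunctionAnyRoot₂ ι v vbar κ₁ κ₂ γ₁⁻¹ γ₂⁻¹ f' (NumberField.discr K).natAbs (NumberField.classNumber K) LK G' → ∀ J : ℤ_[p] →+* PadicComplexInt p, (∀ x : ℤ_[p], ((J x : PadicComplexInt p) : PadicComplex p) = ((x : ℚ_[p]) : PadicComplex p)) → ∃ s : PowerSeries (PadicComplexInt p), s ≠ 0 ∧ Ideal.span {PowerSeries.map (PowerSeries.C (R := PadicComplexInt p)) s} * ((WeierstrassCurve.XGr₂.charIdeal (W.baseChange K) p κ₁ κ₂ vbar γ₁ γ₂).map (Literature.NumberTheory.EllipticCurves.IwasawaAlgebra₂.toUnr₂ p J) * (WeierstrassCurve.XGr₂.charIdeal (W'.baseChange K) p κ₁ κ₂ vbar γ₁ γ₂).map (Literature.NumberTheory.EllipticCurves.IwasawaAlgebra₂.toUnr₂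 p J)) ≤ Ideal.span {G * G'}) → ∀ ε : ℤˣ, Summit.BirchSwinnertonDyer.Rank1Residual.Supersingular.KobayashiMainConjecture W p ε

/-- item stmt-BirchSwinnertonDyer-20515 · support · rank 9 · SPLIT (gen 1) into BCSGreenbergMuInvariantMinus, BSTWSignedTwoVariablePackagePRE + glue SignedTwoVariableInputsGlue · direct attempts still welcome (low priority) · by planner
[support] (SignedTwoVariableInputs, gen 6 = rev 14′; cite-only BY-NAME conjunction of two typed
Literature binders — never a prover target beyond `⟨h₁, h₂⟩`; difficulty cite-only) CONJUNCT 1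
(PUBLISHED, typed p524597, GUARDED v2): Burungale–Castella–Skinner IMRN 2025 = arXiv:2405.00270v2
Prop. 4.2.2 (p. 9), the L_p^Gr half on the minus line at a prime of GOOD reduction p > 2 under
(Heeg) + (spl) + (disc: D_K odd, D_K ≠ −3) + (irr_K) + (N, D_K) = 1: «μ(L_p^Gr(g/K)) =
μ(L_p^BDP(g/K)) = 0» (Hsieh 2014 Thm B + the Gr/BDP comparison), in the ∀-frame currency
`HasUnitContent (minus G)` for every Katz frame with GENUINE period data (Ω ≠ 0, δ² = ±D_K) and
every Greenberg AnyRoot frame over it — VERBATIM the named fact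
`BurungaleCastellaSkinner2025.prop422_greenbergAnyRoot_hasUnitContent_minus` (consumed pointwise by
sbc-p2's landed `Theorems.SignedBaseChangeK2RMuZero.stub_muZero_of_prop422GreenbergAnyRoot`,
p528542). STANDING WARNING: the unguarded v1 `prop422_grHalf_hasUnitContent_minus` (no Ω ≠ 0) is
KERNEL-REFUTED in the same file (`prop422_grHalf_hasUnitContent_minus.false_of_instance`, degenerate
frame Ω = δ = 0, LK = G = 0); an item conjoining v1 would make `closes` rest on False — t -/
@[route_item "route-BirchSwinnertonDyer-SignedBaseChange", crux]
def SignedTwoVariableInputs : Prop :=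
  Literature.NumberTheory.EllipticCurves.BurungaleCastellaSkinner2025.prop422_greenbergAnyRoot_hasUnitContent_minus ∧ Literature.NumberTheory.EllipticCurves.BurungaleSkinnerTianWan2024.props118_27_519_exists_signedTwoVariablePackage_supersingular_PRE

-- parent: SignedTwoVariableInputs · child (gen 1)
/--     item stmt-BirchSwinnertonDyer-20550 · support · rank 901 · open
    parent: SignedTwoVariableInputs · by planner
    sources: BurungaleCastellaSkinner2025, Hsieh2014
[support] Burungale–Castella–Skinner IMRN 2025 (arXiv:2405.00270v2) Prop. 4.2.2 (p. 9), GUARDED v2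
(Ω ≠ 0 genuine Katz period data; every Greenberg AnyRoot frame): μ(L_p^Gr(g/K)⁻) = 0, i.e.
`HasUnitContent (UnrSeries₂.minus G)` — conjunct 1 of SignedTwoVariableInputs
(stmt-BirchSwinnertonDyer-20515), BY NAME; same content, filed as a split child so the head constant
is item-stated (gate5 #15c one rule; readiness rule 2026-08-15: cite_only dep declared by the route
— the PublishedSignedInputs pattern of this route); cite-only, never a prover target; no statement /
closes / tribunal change. WARNING: never substitute the unguarded v1
`prop422_grHalf_hasUnitContent_minus` (kernel-refuted on the degenerate frame,
`….false_of_instance`). -/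
@[route_item "route-BirchSwinnertonDyer-SignedBaseChange"]
def BCSGreenbergMuInvariantMinus : Prop :=
  Literature.NumberTheory.EllipticCurves.BurungaleCastellaSkinner2025.prop422_greenbergAnyRoot_hasUnitContent_minus

-- parent: SignedTwoVariableInputs · child (gen 1)
/--     item stmt-BirchSwinnertonDyer-20551 · support · rank 902 · open
    parent: SignedTwoVariableInputs · by planner
    sources: BurungaleSkinnerTianWan2024
[support] Burungale–Skinner–Tian–Wan 2024 (PREPRINT, typed PRE): Props. 1.18 / 2.7 / 5.19 —
existence of the signed two-variable descent package at a supersingular prime (signed Coleman maps /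
± two-variable p-adic L-functions and the specialisation to Kobayashi's signed objects on the
cyclotomic line) in the tree's `SignedTwoVariablePackage` currency — conjunct 2 of
SignedTwoVariableInputs (stmt-BirchSwinnertonDyer-20515), BY NAME; same content, filed as a split
child so the head constant is item-stated (gate5 #15c one rule; readiness rule 2026-08-15);
cite-only (PRE: preprint-grade named fact), never a prover target; no statement / closes / tribunal
change. -/
@[route_item "route-BirchSwinnertonDyer-SignedBaseChange"]
def BSTWSignedTwoVariablePackagePRE : Prop :=
  Literature.NumberTheory.EllipticCurves.BurungaleSkinnerTianWan2024.props118_27_519_exists_signedTwoVariablePackage_supersingular_PRE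

-- parent: SignedTwoVariableInputs · glue (gen 1)
/--     item stmt-BirchSwinnertonDyer-20552 · support · rank 903 · closed · proved by Summit.BirchSwinnertonDyer.BirchSwinnertonDyer.Theorems.SignedBaseChangeInputsGlueCloser.signedTwoVariableInputsGlue_holds (planner)
    parent: SignedTwoVariableInputs · GLUE: children ⟹ parent · by planner
SignedTwoVariableInputs ⇐ BCSGreenbergMuInvariantMinus ∧ BSTWSignedTwoVariablePackagePRE (And.intro;
by-name proof already landed as SignedBaseChangeRev14Glue.signedTwoVariableInputs_of_facts, p541190
— closer file follows at once) -/
@[route_item "route-BirchSwinnertonDyer-SignedBaseChange"]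
def SignedTwoVariableInputsGlue : Prop :=
  BCSGreenbergMuInvariantMinus → BSTWSignedTwoVariablePackagePRE → SignedTwoVariableInputs

-- `SignedTwoVariableInputsGlue` holds: proved by `Summit.BirchSwinnertonDyer.BirchSwinnertonDyer.Theorems.SignedBaseChangeInputsGlueCloser.signedTwoVariableInputsGlue_holds` (its module imports this route file, so no `_holds` link can be stated here).

/-- item stmt-BirchSwinnertonDyer-20519 · crux · rank 2 · SPLIT (gen 1) into AnticyclotomicEisensteinDivisibility, TwoVariableEulerSystemDivisibility + glue TwistPairCanonicalAcanchorGlue · direct attempts still welcome (low priority) · by planner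
why it might fail: Conjecture-grade. Live line acanchor: K1″ ⇐ two inputs absent from print at additive level — the integral untwisted two-variable Euler-system inclusion (BL16 signed/twisted/fudged; BSTW §9 square-free) and the anticyclotomic Eisenstein inclusion G2″ (Sweeting/Wan need ℓ ∥ N); Thm-A road unprinted.
sources: BurungaleSkinnerTianWan2024, BurungaleCastellaSkinner2025, arXiv:1605.05310, arXiv:2012.11771, arXiv:1804.10993, CastellaLiuWan2022
earlier split gen 2:  — retired -
retired/moot children: AnticyclotomicEisensteinDivisibility [replaced: SignedTwoVariableInputs → Literature.NumberTheory.EllipticCurves.ModularForms.no]; TwoVariableEulerSystemDivisibility [replaced: SignedTwoVariableInputs → Literature.NumberTheory.EllipticCurves.ModularForms.no]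
[crux] (K1″, rev 14″ = K1′ stmt-BirchSwinnertonDyer-20502 + ONE conjunct «γ₁ canonical», stated
MODULO the published inputs: antecedent `SignedTwoVariableInputs →` (item #3g); K1′ → aside; K1″ ∧
Inputs ⇒ K1′ — Sketch14b/Sketch18 `k1split_of_k1canonical`; the DECIDING crux) for p ≥ 5 and an X7
pair (E, p) with surjective ρ̄: an imaginary quadratic K with p = v·v̄ split and every prime ℓ ∣
N·N′ split (three formal conjuncts «ℓ ∣ N», «ℓ ∣ d», «2» — sbc-p1 K1-AUDIT NOTE A), a real quadratic
twist E^(d) (d > 1 square-free, ramified away from p·N·D_K) with minimal model W′ and newform f′,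
the (cyclotomic, anticyclotomic) tower (κ₁, κ₂) with an adapted generator pair (γ₁, γ₂) in which γ₁
IS CANONICAL UP TO TORSION — conjunct placed right after `κ₁.IsCyclotomic ∧ κ₂.IsAnticyclotomic ∧`:
`(∃ ζ : ℤ_[p]ˣ, IsOfFinOrder ζ ∧ χ_cyc,K(γ₁)·ζ = γ_cyc)` with γ_cyc = `cyclotomicGenerator p` = 1 +
p (byte-identical to bsd-wall-ty-1's COORDINATE-CLAUSE-gamma1-v1 d3e8bf8c9470d5b5; = the RHS of
`CastellaGrossiSkinner2025.isCyclotomicVariable_absGaloisRestrict_iff`) — and, uniformly over every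
BSTW Katz frame with Ω ≠ 0 and Greenberg frames (LK, G, G′) and every structure map J, the
two-variable GREENBERG -/
@[route_item "route-BirchSwinnertonDyer-SignedBaseChange", crux]
def TwistPairGreenbergProductDivisibilityCanonical : Prop :=
  SignedTwoVariableInputs → Literature.NumberTheory.EllipticCurves.ModularForms.nonempty_modularParametrizationData → ∀ (W : WeierstrassCurve ℚ) [W.IsElliptic] [W.IsGloballyMinimal] (p : ℕ) [Fact p.Prime], 5 ≤ p → Literature.NumberTheory.EllipticCurves.Rank1Residual.ClassX7 W p → Literature.NumberTheory.EllipticCurves.Rank1Residual.Surj W p → ∃ (K : Type) (_ : Field K) (_ : NumberField K) (ι : PadicAlgCl p ≃+* ℂ) (v vbar : IsDedekindDomain.HeightOneSpectrum (NumberField.RingOfIntegers K)) (κ₁ κ₂ : Literature.NumberTheory.EllipticCurves.ZpExtension K p) (γ₁ γ₂ : Field.absoluteGaloisGroup K) (_ : Fact (Literature.NumberTheory.EllipticCurves.ZpExtension.IsTopGeneratorPair κ₁ κ₂ γ₁ γ₂)) (_ : NeZero (NumberField.discr K).natAbs) (N : ℕ) (_ : NeZero N) (f : CuspForm (CongruenceSubgroup.Gamma0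 N) 2) (d : ℤ) (W' : WeierstrassCurve ℚ) (_ : W'.IsElliptic) (_ : W'.IsGloballyMinimal) (C : WeierstrassCurve.VariableChange ℚ) (N' : ℕ) (_ : NeZero N') (f' : CuspForm (CongruenceSubgroup.Gamma0 N') 2), Literature.NumberTheory.EllipticCurves.ModularForms.IsNewformOf W f ∧ (N : ℤ) = W.conductorNorm ℤ ∧ Literature.NumberTheory.EllipticCurves.ModularForms.IsNewformOf W' f' ∧ (N' : ℤ) = W'.conductorNorm ℤ ∧ Squarefree d ∧ 1 < d ∧ (∀ q : ℕ, q.Prime → Literature.NumberTheory.EllipticCurves.BurungaleSkinnerTianWan2024.RamifiedInQuadratic d q → q ≠ p ∧ ¬ q ∣ N ∧ ¬ (q : ℤ) ∣ NumberField.discr K) ∧ C • W' = W.quadraticTwist (d : ℚ) ∧ Literature.NumberTheory.EllipticCurves.IsImaginaryQuadratic K ∧ ((Ideal.span {(p : ℤ)}).primesOver (NumberField.RingOfIntegers K)).ncard = 2 ∧ ((p : ℕ) : NumberField.RingOfIntegers K) ∈ v.asIdeal ∧ ((p : ℕ) : NumberField.RingOfIntegers K) ∈ vbar.asIdeal ∧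 vbar ≠ v ∧ (∀ (w : NumberField.InfinitePlace K) (k : NumberField.RingOfIntegers K), k ∈ v.asIdeal ↔ ‖ι.symm (w.embedding (k : K))‖ < 1) ∧ IsCoprime (N : ℤ) (NumberField.discr K) ∧ (∀ ℓ : ℕ, ℓ.Prime → ℓ ∣ N → ((Ideal.span {(ℓ : ℤ)}).primesOver (NumberField.RingOfIntegers K)).ncard = 2) ∧ (∀ ℓ : ℕ, ℓ.Prime → (ℓ : ℤ) ∣ d → ((Ideal.span {(ℓ : ℤ)}).primesOver (NumberField.RingOfIntegers K)).ncard = 2) ∧ ((Ideal.span {(2 : ℤ)}).primesOver (NumberField.RingOfIntegers K)).ncard = 2 ∧ (∀ ρ : Literature.NumberTheory.GaloisRepresentations.ModPGaloisRep K (ZMod p) 2, (W.baseChange K).IsTorsionGaloisRep p ρ → Literature.NumberTheory.GaloisRepresentations.FramedRep.IsAbsolutelyIrreducible ρ) ∧ κ₁.IsCyclotomic ∧ κ₂.IsAnticyclotomic ∧ (∃ ζ : ℤ_[p]ˣ, IsOfFinOrder ζ ∧ ((Literature.NumberTheory.GaloisRepresentations.GaloisRep.cyclotomicCharacter K p γ₁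 * ζ : ℤ_[p]ˣ) : ℤ_[p]) = (Literature.NumberTheory.EllipticCurves.cyclotomicGenerator p : ℤ_[p])) ∧ ∀ (Ω δ : ℂ) (Ωp : (Literature.NumberTheory.EllipticCurves.unrIntegers p)ˣ) (LK G G' : PowerSeries (PowerSeries (PadicComplexInt p))), Ω ≠ 0 → (δ ^ 2 = (NumberField.discr K : ℂ) ∨ δ ^ 2 = -(NumberField.discr K : ℂ)) → Literature.NumberTheory.EllipticCurves.IsKatzMeasure₂ ι v vbar ∅ κ₁ κ₂ γ₁⁻¹ γ₂⁻¹ 1 Ω δ ((Ωp : Literature.NumberTheory.EllipticCurves.unrIntegers p) : PadicComplex p) LK → Literature.NumberTheory.EllipticCurves.IsGreenbergLFunctionAnyRoot₂ ι v vbar κ₁ κ₂ γ₁⁻¹ γ₂⁻¹ f (NumberField.discr K).natAbs (NumberField.classNumber K) LK G → Literature.NumberTheory.EllipticCurves.IsGreenbergLFunctionAnyRoot₂ ι v vbar κ₁ κ₂ γ₁⁻¹ γ₂⁻¹ f' (NumberField.discr K).natAbs (NumberField.classNumber K) LK G' → ∀ J : ℤ_[p] →+* PadicComplexInt p, (∀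 x : ℤ_[p], ((J x : PadicComplexInt p) : PadicComplex p) = ((x : ℚ_[p]) : PadicComplex p)) → ∃ s : PowerSeries (PadicComplexInt p), s ≠ 0 ∧ Ideal.span {PowerSeries.map (PowerSeries.C (R := PadicComplexInt p)) s} * ((WeierstrassCurve.XGr₂.charIdeal (W.baseChange K) p κ₁ κ₂ vbar γ₁ γ₂).map (Literature.NumberTheory.EllipticCurves.IwasawaAlgebra₂.toUnr₂ p J) * (WeierstrassCurve.XGr₂.charIdeal (W'.baseChange K) p κ₁ κ₂ vbar γ₁ γ₂).map (Literature.NumberTheory.EllipticCurves.IwasawaAlgebra₂.toUnr₂ p J)) ≤ Ideal.span {G * G'}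

-- parent: TwistPairGreenbergProductDivisibilityCanonical · child (gen 1)
/--     item stmt-BirchSwinnertonDyer-20727 · crux · rank 201 · open
    parent: TwistPairGreenbergProductDivisibilityCanonical · by planner
    why it might fail: Open at additive level (= G2″): the Eisenstein/primitivity inclusion in print needs ∃ ℓ ∥ N and N square-free (Sweeting 2012.11771 Thm 10.2 ⟸ Wan 1411.6352) or p ordinary (BCK 1908.09512 Hyp ♠); X7 levels may have no such ℓ; the control factor ch(X[T₁]) sits on the wrong side.
    sources: arXiv:2012.11771, arXiv:1411.6352, arXiv:1908.09512, arXiv:1804.10993, arXiv:1607.02019, arXiv:2601.14504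
[crux, rank 2 — child of K1″ TwistPairGreenbergProductDivisibilityCanonical along the live line
`acanchor` (cstrat-20502 line, lead sbc-p1 g4 PICKED 13:21Z); the card's kernel G2″; text =
registered skeleton v2 (19a9c6f03a6f73a0) `stub_acDiv` with names qualified, stated MODULO the
published-inputs conjunction `SignedTwoVariableInputs →`] ANTICYCLOTOMIC EISENSTEIN INCLUSION ON THE
LINE T₁ = 0. Modularity (named fact) ⇒ for every globally minimal W/ℚ, every good prime p ≥ 5 with
ρ̄ surjective, every imaginary quadratic K of Heegner type for N = cond(W) (p = v·v̄ split, every ℓ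
∣ N split, (N, D_K) = 1, D_K odd, D_K ≠ −3), the (cyclotomic, anticyclotomic) tower (κ₁, κ₂) with an
adapted top-generator pair (γ₁, γ₂), every BSTW Katz frame (Ω ≠ 0, δ² = ±D_K, unit p-adic period Ωp,
Katz measure LK) carrying a Greenberg two-variable p-adic L-function G of f_W (any root), and every
structure map J : ℤ_p → 𝒪_ℂp: the constant-in-T₁ coefficient of the unramified base change of the
two-variable Greenberg characteristic ideal ch(X_Gr₂(E/K_∞)) (relaxed at v̄, strict at v) is
contained in the principal ideal of G⁻ = `UnrSeries₂.minus G` (the restriction of G to the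
anticyclotomic line): `constantCo -/
@[route_item "route-BirchSwinnertonDyer-SignedBaseChange"]
def AnticyclotomicEisensteinDivisibility : Prop :=
  (Literature.NumberTheory.EllipticCurves.BurungaleCastellaSkinner2025.prop422_greenbergAnyRoot_hasUnitContent_minus ∧ Literature.NumberTheory.EllipticCurves.BurungaleSkinnerTianWan2024.props118_27_519_exists_signedTwoVariablePackage_supersingular_PRE) → Literature.NumberTheory.EllipticCurves.ModularForms.nonempty_modularParametrizationData → ∀ (W : WeierstrassCurve ℚ) [W.IsElliptic] [W.IsGloballyMinimal] (p : ℕ) [Fact p.Prime], 5 ≤ p → W.HasGoodReductionAtPrime p → Literature.NumberTheory.EllipticCurves.Rank1Residual.Surj W p → ∀ (K : Type) [Field K] [NumberField K] (ι : PadicAlgCl p ≃+* ℂ) (v vbar : IsDedekindDomain.HeightOneSpectrum (NumberField.RingOfIntegers K)) (κ₁ κ₂ : Literature.NumberTheory.EllipticCurves.ZpExtension K p) (γ₁ γ₂ : Field.absoluteGaloisGroup K) [Fact (Literature.NumberTheory.EllipticCurves.ZpExtension.IsTopGeneratorPair κ₁ κ₂ γ₁ γ₂)] [NeZero (NumberField.discr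 K).natAbs] (N : ℕ) [NeZero N] (f : CuspForm (CongruenceSubgroup.Gamma0 N) 2), Literature.NumberTheory.EllipticCurves.ModularForms.IsNewformOf W f → (N : ℤ) = W.conductorNorm ℤ → Literature.NumberTheory.EllipticCurves.IsImaginaryQuadratic K → ((Ideal.span {(p : ℤ)}).primesOver (NumberField.RingOfIntegers K)).ncard = 2 → ((p : ℕ) : NumberField.RingOfIntegers K) ∈ v.asIdeal → ((p : ℕ) : NumberField.RingOfIntegers K) ∈ vbar.asIdeal → vbar ≠ v → (∀ (w : NumberField.InfinitePlace K) (k : NumberField.RingOfIntegers K), k ∈ v.asIdeal ↔ ‖ι.symm (w.embedding (k : K))‖ < 1) → IsCoprime (N : ℤ) (NumberField.discr K) → (∀ ℓ : ℕ, ℓ.Prime → ℓ ∣ N → ((Ideal.span {(ℓ : ℤ)}).primesOver (NumberField.RingOfIntegers K)).ncard = 2) → Odd (NumberField.discr K) → NumberField.discr K ≠ -3 → κ₁.IsCyclotomic → κ₂.IsAnticyclotomic → ∀ (Ω δ : ℂ) (Ωp : (Literature.NumberTheory.EllipticCurves.unrIntegers p)ˣ) (LK G : PowerSeries (PowerSeries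 (PadicComplexInt p))), Ω ≠ 0 → (δ ^ 2 = (NumberField.discr K : ℂ) ∨ δ ^ 2 = -(NumberField.discr K : ℂ)) → Literature.NumberTheory.EllipticCurves.IsKatzMeasure₂ ι v vbar ∅ κ₁ κ₂ γ₁⁻¹ γ₂⁻¹ 1 Ω δ ((Ωp : Literature.NumberTheory.EllipticCurves.unrIntegers p) : PadicComplex p) LK → Literature.NumberTheory.EllipticCurves.IsGreenbergLFunctionAnyRoot₂ ι v vbar κ₁ κ₂ γ₁⁻¹ γ₂⁻¹ f (NumberField.discr K).natAbs (NumberField.classNumber K) LK G → ∀ J : ℤ_[p] →+* PadicComplexInt p, (∀ x : ℤ_[p], ((J x : PadicComplexInt p) : PadicComplex p) = ((x : ℚ_[p]) : PadicComplex p)) → ((WeierstrassCurve.XGr₂.charIdeal (W.baseChange K) p κ₁ κ₂ vbar γ₁ γ₂).map (Literature.NumberTheory.EllipticCurves.IwasawaAlgebra₂.toUnr₂ p J)).map (PowerSeries.constantCoeff (R := PowerSeries (PadicComplexInt p))) ≤ Ideal.span {Literature.NumberTheory.EllipticCurves.UnrSeries₂.minus G}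

-- parent: TwistPairGreenbergProductDivisibilityCanonical · child (gen 1)
/--     item stmt-BirchSwinnertonDyer-20728 · crux · rank 202 · open
    parent: TwistPairGreenbergProductDivisibilityCanonical · by planner
    why it might fail: Not in print as stated (integral, untwisted, all N): BL arXiv:1605.05310 Thm 1.3 is signed, p-distinguished twists only, with a fudge ξ; CÇSS 1804.10993 Thm 3.7 is an equivalence; BSTW 2409.01350 §9 needs N square-free; a fudge with ξ(0,T₂) non-unit breaks the anchor step.
    sources: arXiv:1605.05310, arXiv:1804.10993, arXiv:2409.01350, arXiv:2511.08793, arXiv:1503.02888, arXiv:1607.02019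
[crux, rank 3 — child of K1″ TwistPairGreenbergProductDivisibilityCanonical along the live line
`acanchor`; text = registered skeleton v2 (19a9c6f03a6f73a0) `stub_eulerSystemDivisibility` with
names qualified, stated MODULO the published-inputs conjunction `SignedTwoVariableInputs →` (so that
further published named facts it needs — explicit reciprocity laws, big-image lemmas — can be
appended to that conjunction by a 1:1 restate without touching this text)] INTEGRAL TWO-VARIABLE
EULER-SYSTEM INCLUSION. Same data as the sibling AnticyclotomicEisensteinDivisibility (W globally
minimal, good p ≥ 5, ρ̄ surjective, Heegner-type K with p split, tower (κ₁, κ₂), adapted pair (γ₁,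
γ₂), BSTW Katz frame with Ω ≠ 0, Greenberg two-variable p-adic L-function G of f_W, structure map
J): the principal ideal (G) is contained in the unramified base change of the two-variable Greenberg
characteristic ideal: `Ideal.span {G} ≤ ch(X_Gr₂(E/K_∞))^ur` in 𝒪_ℂp⟦T₁,T₂⟧ — i.e. ch(X_Gr₂) ∣ G,
the upper bound on the (relaxed, strict) Selmer group, UNTWISTED (χ = 1), with NO fudge factor, for
arbitrary conductor N. ROLE: first hypothesis of the landed anchor composition (AcanchorGlue §4–§5);
with the sibling and -/
@[route_item "route-BirchSwinnertonDyer-SignedBaseChange"]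
def TwoVariableEulerSystemDivisibility : Prop :=
  (Literature.NumberTheory.EllipticCurves.BurungaleCastellaSkinner2025.prop422_greenbergAnyRoot_hasUnitContent_minus ∧ Literature.NumberTheory.EllipticCurves.BurungaleSkinnerTianWan2024.props118_27_519_exists_signedTwoVariablePackage_supersingular_PRE) → Literature.NumberTheory.EllipticCurves.ModularForms.nonempty_modularParametrizationData → ∀ (W : WeierstrassCurve ℚ) [W.IsElliptic] [W.IsGloballyMinimal] (p : ℕ) [Fact p.Prime], 5 ≤ p → W.HasGoodReductionAtPrime p → Literature.NumberTheory.EllipticCurves.Rank1Residual.Surj W p → ∀ (K : Type) [Field K] [NumberField K] (ι : PadicAlgCl p ≃+* ℂ) (v vbar : IsDedekindDomain.HeightOneSpectrum (NumberField.RingOfIntegers K)) (κ₁ κ₂ : Literature.NumberTheory.EllipticCurves.ZpExtension K p) (γ₁ γ₂ : Field.absoluteGaloisGroup K) [Fact (Literature.NumberTheory.EllipticCurves.ZpExtension.IsTopGeneratorPair κ₁ κ₂ γ₁ γ₂)] [NeZero (NumberField.discr K).natAbs] (N : ℕ) [NeZero N] (f : CuspForm (CongruenceSubgroup.Gamma0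 N) 2), Literature.NumberTheory.EllipticCurves.ModularForms.IsNewformOf W f → (N : ℤ) = W.conductorNorm ℤ → Literature.NumberTheory.EllipticCurves.IsImaginaryQuadratic K → ((Ideal.span {(p : ℤ)}).primesOver (NumberField.RingOfIntegers K)).ncard = 2 → ((p : ℕ) : NumberField.RingOfIntegers K) ∈ v.asIdeal → ((p : ℕ) : NumberField.RingOfIntegers K) ∈ vbar.asIdeal → vbar ≠ v → (∀ (w : NumberField.InfinitePlace K) (k : NumberField.RingOfIntegers K), k ∈ v.asIdeal ↔ ‖ι.symm (w.embedding (k : K))‖ < 1) → IsCoprime (N : ℤ) (NumberField.discr K) → (∀ ℓ : ℕ, ℓ.Prime → ℓ ∣ N → ((Ideal.span {(ℓ : ℤ)}).primesOver (NumberField.RingOfIntegers K)).ncard = 2) → Odd (NumberField.discr K) → NumberField.discr K ≠ -3 → κ₁.IsCyclotomic → κ₂.IsAnticyclotomic → ∀ (Ω δ : ℂ) (Ωp : (Literature.NumberTheory.EllipticCurves.unrIntegers p)ˣ) (LK G : PowerSeries (PowerSeries (PadicComplexInt p))), Ω ≠ 0 → (δ ^ 2 = (NumberField.discr K : ℂ)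 ∨ δ ^ 2 = -(NumberField.discr K : ℂ)) → Literature.NumberTheory.EllipticCurves.IsKatzMeasure₂ ι v vbar ∅ κ₁ κ₂ γ₁⁻¹ γ₂⁻¹ 1 Ω δ ((Ωp : Literature.NumberTheory.EllipticCurves.unrIntegers p) : PadicComplex p) LK → Literature.NumberTheory.EllipticCurves.IsGreenbergLFunctionAnyRoot₂ ι v vbar κ₁ κ₂ γ₁⁻¹ γ₂⁻¹ f (NumberField.discr K).natAbs (NumberField.classNumber K) LK G → ∀ J : ℤ_[p] →+* PadicComplexInt p, (∀ x : ℤ_[p], ((J x : PadicComplexInt p) : PadicComplex p) = ((x : ℚ_[p]) : PadicComplex p)) → Ideal.span {G} ≤ (WeierstrassCurve.XGr₂.charIdeal (W.baseChange K) p κ₁ κ₂ vbar γ₁ γ₂).map (Literature.NumberTheory.EllipticCurves.IwasawaAlgebra₂.toUnr₂ p J)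

-- parent: TwistPairGreenbergProductDivisibilityCanonical · child (gen 1)
/--     item stmt-BirchSwinnertonDyer-20578 · support · rank 203 · closed · proved by Summit.BirchSwinnertonDyer.BirchSwinnertonDyer.Theorems.SignedBaseChangeAcanchorGlueCloser.twistPairCanonicalAcanchorGlue_holds (planner)
    parent: TwistPairGreenbergProductDivisibilityCanonical · by planner
K1″ ⇐ TwoVariableEulerSystemDivisibility (integral two-variable Euler-system inclusion (G) ⊆
ch(X_Gr₂)^ur) ∧ AnticyclotomicEisensteinDivisibility (G2″: constantCoeff ch^ur ⊆ (G⁻)) via μ(G⁻) = 0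
(BCS25 Prop 4.2.2 v2 = SignedTwoVariableInputs.1) and the strategist's rigidity/anchor argument, for
f_W and the twist f_W′ on the common frame — LANDED
Theorems/SignedBaseChangeTwistPairGreenbergProductDivisibilitySplitAcanchorGlue.lean
(p534867/p536497) ; glue LANDED by name: Theorems/SignedBaseChangeRev14Glue.lean  (p541190 ✓;
--glue-by refused for modules importing the route file, so the glue is an ITEM closed by a one-line
Theorems file); pre-certified HOME/bsd-wall-ss/rev15-AC/Sketch18.lean -/
@[route_item "route-BirchSwinnertonDyer-SignedBaseChange"]
def TwistPairCanonicalAcanchorGlue : Prop :=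
  AnticyclotomicEisensteinDivisibility → TwoVariableEulerSystemDivisibility → TwistPairGreenbergProductDivisibilityCanonical

-- `TwistPairCanonicalAcanchorGlue` holds: proved by `Summit.BirchSwinnertonDyer.BirchSwinnertonDyer.Theorems.SignedBaseChangeAcanchorGlueCloser.twistPairCanonicalAcanchorGlue_holds` (its module imports this route file, so no `_holds` link can be stated here).

/-- item stmt-BirchSwinnertonDyer-20521 · crux (kind.auto-crux: conjecture-grade) · rank 3 · closed · proved by Summit.BirchSwinnertonDyer.BirchSwinnertonDyer.Theorems.signedLowerDescentFromTwoVariablePackage_proof (prover) · by planner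
why it might fail: Dictionary seams only, each already cost this route a restate: Kobayashi's ε vs BSTW ±/∘ (UnrSeries₂.plus); IsSignedPAdicLFunction ↔ Summit-side kobayashiL/Pollack pairs (unit, p-adic period); minimal models, newforms and Thm 4.1 hypotheses for the auxiliary twists E^(D_K), E^(d), E^(dD_K).
sources: Kobayashi2003, BurungaleSkinnerTianWan2024, BurungaleCastellaSkinner2025, BDKim2013, Pollack2003
[crux] (K2R⁗ = SignedLowerDescentFromTwoVariablePackage, gen 6 = rev 14′, BY-NAME form, 675 chars;
supersedes K2R‴ stmt-BirchSwinnertonDyer-20213 → aside; conclusion IDENTICAL to K2R‴) signed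
two-variable descent: from Kobayashi Thm 4.1 / Thm 1.2 (named facts), modularity and the period-unit
fact (PUB aliases ModularParametrizationSupply, RealPeriodUnitPlusPeriod — rev 12), the BSTW
common-frame binder GSF (GreenbergSupersingularFrameInput 20330, unchanged), the two SIGNED INPUTS
(SignedTwoVariableInputs: BCS25 Prop 4.2.2 v2 μ-input ∧ BSTW (P1)–(P3) package PRE) and K1″'s
Greenberg PRODUCT package for the twist pair (TwistPairGreenbergProductDivisibilityCanonical, BY
NAME), conclude for every p ≥ 5, ClassX7, Surj pair the EISENSTEIN HALF `∀ ε,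
KobayashiLowerDivisibility W p ε` (char X^ε = (g), ι g = ϖ·ι(L^ε·h)); the squeeze to Kobayashi's
main conjecture stays the proved glue KobayashiSqueeze (20504, p516518). WHY BY NAME: the pointwise
text (K2R‴'s ∀-package′ + the new conjunct + two more antecedents) is 4 185 chars > the 4 000-char
cap, and the by-name form retires the «package texts must match verbatim» seam that produced the
binder omissions F3 (rev 12) and F4′ (sbc-p2 11:44Z): -/
@[route_item "route-BirchSwinnertonDyer-SignedBaseChange", crux]
def SignedLowerDescentFromTwoVariablePackage : Prop :=
  Literature.NumberTheory.EllipticCurves.Kobayashi2003.thm41_signedCharIdeal_divisibility → Literature.NumberTheory.EllipticCurves.Kobayashi2003.thm12_signedSelmerDual_finite_torsion → ModularParametrizationSupply → RealPeriodUnitPlusPeriod → GreenbergSupersingularFrameInput → SignedTwoVariableInputs → TwistPairGreenbergProductDivisibilityCanonical → ∀ (W : WeierstrassCurve ℚ) [W.IsElliptic] [W.IsGloballyMinimal] (p : ℕ) [Fact p.Prime], 5 ≤ p → Literature.NumberTheory.EllipticCurves.Rank1Residual.ClassX7 W p → Literature.NumberTheory.EllipticCurves.Rank1Residual.Surj W p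 → ∀ ε : ℤˣ, Summit.BirchSwinnertonDyer.Rank1Residual.Supersingular.KobayashiLowerDivisibility W p ε

-- `SignedLowerDescentFromTwoVariablePackage` holds: proved by `Summit.BirchSwinnertonDyer.BirchSwinnertonDyer.Theorems.signedLowerDescentFromTwoVariablePackage_proof` (its module imports this route file, so no `_holds` link can be stated here).

/-- item stmt-BirchSwinnertonDyer-33118 · support · rank 204 · open · by planner
[support · declared LINE-RESIDUAL of 20727 (K1 stub_definiteAnchorNFW, admdef v23 0da8f8faa6cd709b)
· conjecture-class · no print source · never benched as print] (Anch)_¬FW — the registered text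
`AdmdefLine.DefiniteAnchorNFWNS` VERBATIM (fully qualified, sha16 348bd4b61cba8243; pen preflight B
rfl-equal, farm rc 0): on cell β of the W-ALL corner 7.p≥5 (E/ℚ with (N : ℤ) = N_E the level of its
newform f, p ≥ 5 good supersingular with a_p = 0, ρ̄_{E,p} onto, K imaginary quadratic with p and
every ℓ ∣ N split, (N, D_K) = 1, p ∤ h_K, N NOT square-free, E[p] ramified at every q ∣ N) and OFF
the Fouquet–Wan locus (¬ Rank1Residual.Additive.FWNonsplitRam W p: no non-split multiplicative q ≠ p
with E[p] ramified), at every ODD ZERO VERTEX n of the level-raised Selmer walk (Sel_n^± = 0 in the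
AKR currency SelQP) there are definite Brandt data at level N·∏n (XiSetup, a Gross point of K, a
mod-p a_•(E)-eigenvector off the level) with NON-ZERO WEIGHTED toric period — i.e. the rank-0 mod-p
converse ∕ Eisenstein lower bound for the non-ordinary level-raised forms g_n, g_n ⊗ χ_K whose level
has no ρ̄-ramified non-split Steinberg prime. WHY IT MIGHT FAIL: every printed engine misses exactly
this lo -/
@[route_item "route-BirchSwinnertonDyer-SignedBaseChange"]
def DefiniteAnchorNonFW : Prop :=
  Summit.BirchSwinnertonDyer.BirchSwinnertonDyer.Theorems.SignedBaseChangeDefiniteAnchorDefs.DefiniteAnchorNonFW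

/-- item stmt-BirchSwinnertonDyer-20252 · assembly · rank 1 · closed · proved by Summit.BirchSwinnertonDyer.BirchSwinnertonDyer.Theorems.SignedBaseChangeAssembly.assembly_holds (planner) · by planner
sources: Kobayashi2003, BDKim2013, BurungaleKobayashiOta2023
[assembly] the bridge K1 → K2 → K3 → R → support → WAllCornerX7; PROVABLE NOW — the 25-line proof is
`assembly_holds` in the seat's Sketch.lean (rc 0, 0 sorries; copy at
run/shared/lean/pub/bsd-wall/bsd-wall-ss/Sketch.lean): case split 5 ≤ p / p = 3,
`ClassX7.frobeniusTrace_eq_zero_of_five_le`, Surj/¬Surj, then the landed consumers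
`Supersingular.bsdp_of_kobayashiMainConjecture_of_analyticRank_eq_zero` /
`Supersingular.X7.bsdp_of_kobayashiMainConjecture_of_corA5_of_analyticRank_eq_one`. The deciding
theorem is `closes hAsm h₁ … h₅ := hAsm h₁ h₂ h₃ h₄ h₅` (pattern of route SignedLowerHalves). -/
@[route_item "route-BirchSwinnertonDyer-SignedBaseChange"]
def Assembly : Prop :=
  TwistPairGreenbergProductDivisibility → SignedDescentFromGreenbergProduct → KobayashiMainConjectureSmallImage → CornerX7AtThree → PublishedSignedInputs → Summit.BirchSwinnertonDyer.WAllCornerX7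

-- `Assembly` holds: proved by `Summit.BirchSwinnertonDyer.BirchSwinnertonDyer.Theorems.SignedBaseChangeAssembly.assembly_holds` (its module imports this route file, so no `_holds` link can be stated here).

/-! D-0027 §2.1 — DECIDING THEOREM (planner-authored via `route open/edit --closes-file`; by planner-bsd-wall-ss-g6-0 2026-08-27T14:49:42Z):
its hypotheses are this route's items and its conclusion the registered leaf `Summit.BirchSwinnertonDyer.WAllCornerX7FiveLe` (rung W-ALL/7.p>=5, D-0061) (glue_lint), and it elaborates with this file. -/

/-- rev 14″ deciding theorem: closes over (K1″, GSF, SignedTwoVariableInputs, K2R⁗, K3, PUB, Sq). -/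
@[closes "route-BirchSwinnertonDyer-SignedBaseChange"] theorem closes (h₁ : TwistPairGreenbergProductDivisibilityCanonical) (hGF : GreenbergSupersingularFrameInput)
    (hIn : SignedTwoVariableInputs) (h₂ : SignedLowerDescentFromTwoVariablePackage)
    (h₃ : KobayashiMainConjectureSmallImage) (h₅ : PublishedSignedInputs) (hSq : KobayashiSqueeze) :
    Summit.BirchSwinnertonDyer.WAllCornerX7FiveLe := by
  intro W _ _ p _ hp5 hcm hX hr
  obtain ⟨-, h12, h41, hKim, hA5, h5, -, hmodP, hmod, hGZK⟩ := h₅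
  have hp2 : p ≠ 2 := by omega
  have hap : W.frobeniusTrace p = 0 :=
    Summit.BirchSwinnertonDyer.Rank1Residual.Supersingular.ClassX7.frobeniusTrace_eq_zero_of_five_le W p hp5 hX
  have hirr := Literature.NumberTheory.EllipticCurves.Rank1Residual.ClassX7.irr W p hp2 hX
  have hMC : ∃ ε : ℤˣ, Summit.BirchSwinnertonDyer.Rank1Residual.Supersingular.KobayashiMainConjecture W p ε := by
    by_cases hs : Literature.NumberTheory.EllipticCurves.Rank1Residual.Surj W p
    · exact ⟨1, hSq h12 h41 W p hp2 hX.1.1 hap hs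
        (fun f hf ϖ hϖ => Literature.NumberTheory.EllipticCurves.Rank1Residual.padicValRat_periodRatio_eq_zero_of_five_le
          h5 W p hp5 hX.1.1 hirr f hf ϖ hϖ)
        1 (h₂ h41 h12 hmodP h5 hGF hIn h₁ W p hp5 hX hs 1)⟩
    · exact h₃ W p hp2 hX hcm hap hs
  obtain ⟨ε, hε⟩ := hMC
  rcases Nat.le_one_iff_eq_zero_or_eq_one.mp hr with h0 | h1
  · exact Summit.BirchSwinnertonDyer.Rank1Residual.Supersingular.bsdp_of_kobayashiMainConjecture_of_analyticRank_eq_zero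
      W p h12 hKim Literature.NumberTheory.EllipticCurves.pollack_exists_plusMinusPAdicLFunction_holds hmodP hmod hGZK
      hp2 hX.1.1 hap hirr h0 hε
  · exact Summit.BirchSwinnertonDyer.Rank1Residual.Supersingular.X7.bsdp_of_kobayashiMainConjecture_of_corA5_of_analyticRank_eq_one
      W p hA5 hmod hGZK hp2 hX hap h1 ε hε

end Summit.BirchSwinnertonDyer.BirchSwinnertonDyer.Theses.SignedBaseChange
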